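import Literature.MathematicalPhysics.QuantumFieldTheory.Balaban1983to89.B9RWSums346TwoGp
import Literature.MathematicalPhysics.QuantumFieldTheory.Balaban1983to89.B9CoRealizesRel
import Literature.MathematicalPhysics.QuantumFieldTheory.Balaban1983to89.B9RWSumsReadsNbr

/-!
# `Balaban1983to89.B9RWSumsAllBlocksNbr` — Theorems 3.7 and 3.10 of [B9] at the ALL-BLOCKS pins with NO displayed residual, the
# (3.42) co-readings RELATIVE to a block equivalence and the (3.43)–(3.46) co-readings OBSERVED ON THE METRIC NEIGHBOURHOOD of y

T. Bałaban, *Propagators for lattice gauge theories in a background field*, Commun. Math. Phys. **99** (1985) 389–434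
[`Balaban1985BackgroundPropagators`, "B9"], Thm 3.7 (3.88)–(3.90) p. 409, Thm 3.10 (3.105)–(3.108) pp. 414–416, Thm 3.1 ∕ 3.3
(3.42)–(3.47) pp. 397–399; p. 410: *"Theorem 3.7 implies that all the inequalities (3.42)–(3.47) hold for G′"*; p. 416: *"From (3.108)
it follows that the expansion (3.107) is convergent in all norms in the inequalities (3.42)–(3.47). This implies Theorem 3.3."*;
[4] = T. Bałaban, *Propagators and renormalization transformations for lattice gauge theories. II*, Commun. Math. Phys. **96** (1984)
223–250 [`Balaban1984PropagatorsII`], (2.51)–(2.52) p. 232, Lemma 2.1 p. 234.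

statement-level skeleton of published theorems with citation tags; proofs where landed; nothing here is a claim about the
Yang–Mills mass gap

WHY THIS FILE.  The `Rel` leaves of this lineage (`B9RWSumsAllBlocksRel.thm310Printed_allPin_completeRel`,
`thm37Printed_allPin_completeRel`, p495821) read the (3.43)–(3.46) members through the schemas `L2ReadsRel` ∕ `H1ReadsRel` ∕ `InputReadsRel`,
whose observation is sited on the CLASS of y; at the record geometry (`geo9Y x = geo9K x.toKIdx`) the cut-off predicates `cutIn = cutInT`
are the Δ̃-reading and n06-d's coordinate evaluation `evBK` over-counts the fibre-L² size, so those schemas are not dischargeable there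
(`B9RWSumsReadsRelNegative.not_l2ReadsRel_evBK`; the located obstructions (O1)∕(O2) of this seat's reading layer).  This file re-derives
BOTH leaves with the (3.43)–(3.46) co-readings in the NEIGHBOURHOOD-SITED species `B9RWSumsReadsNbr.L2ReadsNbr` ∕ `H1ReadsNbr` ∕
`InputReadsNbr` (support side still relative to `Rel`; observation radius `r`; evaluation constant `Cev`), keeping the (3.42) co-readings
`CoRealizesRel` (n06-l) and the (3.47) readings `GlobReads` unchanged.  The new geometric binders are the neighbourhood count
`(nbr g r y).card ≤ mN`, the level comparability `d(a,a′) ≤ r ⇒ Lʲ⁽ᵃ⁾η ≤ CL·Lʲ⁽ᵃ′⁾η` (1 ≦ CL), the triangle inequality of d and 0 ≦ δ₀;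
the multiplicities are folded into the constants' relations (mN·m·Cev·CL²·e^{rδ₀}·C·L₀ ≦ B₀ etc.).  The member lines are proved through the
siblings' READING-FREE operator lemmas (`blockBd_entry0∕1∕2`, `blockBd_pair_of_transpose`, `holder343_of_local310∕37`, `lap_of_local310∕37`,
`input3445_of_local310∕37`, `l2line4_of_local310∕37`) and the neighbourhood engines of `B9RWSumsReadsNbr` — no chain of intermediate leaves.
The model operators of the three second-order L² lines (n = 3: `Lap ∘ₗ G`, n = 4: `D ∘ₗ G ∘ₗ Dstar`, n = 5: `G ∘ₗ Lap`) are UNCHANGED here;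
per the lit-balaban desk answer of record (2026-08-27) print's (3.46) members 3∕4∕5 are ‖h∇_U∇_UGλ‖, ‖h∇_UG∇\*_Uλ‖, ‖hG∇\*_U∇\*_Uλ‖ — the
Laplacian lines 3 and 5 of this lineage are trace consequences, not printed members, and their re-modelling by iterated one-sided
differences is a separate file of this cascade.

* §0 private bookkeeping (weakening a line's constant; a probe majorant's constant ∕ rate; the six L² lines; «M sufficiently large»).
* §1 ★ `allIneqs_of_majorants_nbr` — Theorem 3.1 ∕ 3.3's whole typed block `Ineq342_346_347 K B₀ δ₀ U ∧ Ineq343_345 K Bβ Bε Bεβ δ₀ U`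
  at one member and one U from the four sup majorants, the operator-level majorants of the other members, the relative (3.42)
  co-readings and the neighbourhood-sited (3.43)–(3.46) co-readings (constants: m·C ≦ B₀, mN·m·Cev·CL²·e^{rδ₀}·C·L₀ ≦ B₀,
  mN·m·Cev·CL²·e^{rδ₀}·√(CK₅)·L₀ ≦ B₀, mN·m·Cev·CL²·e^{rδ₀}·K₄ ≦ B₀, m·CL·e^{rδ₀}·B_h(β) ≦ B(β), e^{rδ₀}·K₄₄(ε) ≦ B′(ε), CL·e^{rδ₀}·K₄₅(ε,β) ≦ B′(ε,β)).
* §2 ★★ `thm310Printed_allPin_completeNbr` — Theorem 3.10 at `W310OfOps … (ConvAll3107 … K B₀ δ₀ Bβ Bε Bεβ)`, G side.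
* §3 ★★ `thm37Printed_allPin_completeNbr` — Theorem 3.7 at `E37AllOfOps …`, G′ side.

HONEST SCOPE.  Kernel bookkeeping over landed modules; every operator-level input (Cor. 3.6's blocks and legs, (3.89), the structure
(3.88) ∕ (3.105), the static sizes), every co-reading schema, every letter and the member facts of [4] Lemma 2.1 remain HYPOTHESES of
printed shape; the record-level instance of `Rel` (same carrier block), m, mN, Cev, CL and the saturation facts are the instance seat's
(at `geo9Y`: `CL := ℓ+1` from the level gap, the triangle inequality and symmetry by name).  NOT a node discharge; count-neutral; one finite
𝕋^{d+1} programme at fixed ε — nothing continuum, nothing about the mass gap.  Cell `pub-ymgap` (HUMAN RULING D-0062), Track A node N06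
[B9], N06-ASSIGNMENT v1 bundle F6 (rows 18–19), seat `pub-ymgap-dag-n06-k` (gen 8), 2026-08-27.
-/

namespace Literature.MathematicalPhysics.QuantumFieldTheory.Balaban1983to89.B9RWSumsAllBlocksNbr

open Literature.MathematicalPhysics.QuantumFieldTheory.Balaban1983to89
open Finset B6RandomWalk B6RandomWalkHom B9Thm34Ext B9Thm37Whole B9Cor38Whole B9Thm310Whole B9RWSums343to347Whole
open B9RWSums346Schur B9RWSums343Holder B9RWSums346Lap B9RWSums344Input B9RWSums346Two B9Thm37GlueCor36
open B9SectCDiffDict B9SectDL2Decay B11SectG B9Thm37AllNorms B9Thm37AllNormsInstances B9Ineq347 B9Ineq347AllEntries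
open B9CoRealizesRel B9RWSumsReadsRel B9RWSumsReadsNbr B9Thm37Sum B9Thm37Glue B9RWSums343HolderGp B9RWSums344InputGp B9RWSums346TwoGp

noncomputable section

/-! ## §0 Bookkeeping helpers (weakening a member line's constant; a probe majorant's constant ∕ rate) -/

section Helpers

variable {g : B9.Geometry} [Fintype g.Site] {R : ℝ} {H : Prop} {B : B9.Backgrounds}

omit [Fintype g.Site] in
/-- weakening the constant of an L² line of (3.46). [folklore] -/
private theorem l2line_weaken {K : B9.KernelFamily g B} {U : B.Cfg} {n : Fin 6} {b b' δ₀ : ℝ} (hbb : b ≤ b')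
    (hlen : ∀ y : g.Site, 0 ≤ g.len y) (hcut : ∀ h : g.Cut, 0 ≤ g.cutSup h) (hl2 : ∀ lam : g.Loc, 0 ≤ g.l2Norm lam)
    (h : ∀ (lam : g.Loc) (h : g.Cut) (y y' : g.Site), g.cutIn h y → g.suppIn lam y' →
      K.l2 n U lam h ≤ b * B9.pref6 (g.len y) n * g.cutSup h * Real.exp (-(δ₀ * g.dist y y')) * g.l2Norm lam) :
    ∀ (lam : g.Loc) (h : g.Cut) (y y' : g.Site), g.cutIn h y → g.suppIn lam y' →
      K.l2 n U lam h ≤ b' * B9.pref6 (g.len y) n * g.cutSup h * Real.exp (-(δ₀ * g.dist y y')) * g.l2Norm lam :=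
  fun lam hh y y' hc hs => (h lam hh y y' hc hs).trans
    (mul_le_mul_of_nonneg_right (mul_le_mul_of_nonneg_right (mul_le_mul_of_nonneg_right
      (mul_le_mul_of_nonneg_right hbb (B9FromB6.pref6_nonneg (hlen y) n)) (hcut hh)) (Real.exp_nonneg _)) (hl2 lam))

omit [Fintype g.Site] in
/-- weakening the constant of the (3.43) line. [folklore] -/
private theorem line343_weaken {K : B9.KernelFamily g B} {U : B.Cfg} {b b' : ℝ → ℝ} {δ₀ : ℝ}
    (hbb : ∀ β, 0 ≤ β → β < 1 → b β ≤ b' β) (hlen : ∀ y : g.Site, 0 ≤ g.len y)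
    (hcutH : ∀ (β : ℝ) (ζ : g.Cut), 0 ≤ g.cutH β ζ) (hN : ∀ lam : g.Loc, 0 ≤ g.supNorm lam)
    (h : ∀ (β : ℝ) (lam : g.Loc) (ζ : g.Cut) (y y' : g.Site), 0 ≤ β → β < 1 → g.cutInT ζ y → g.suppIn lam y' →
      K.h1 U lam β ζ ≤ b β * (g.len y) ^ (1 - β) * g.cutH β ζ * Real.exp (-(δ₀ * g.dist y y')) * g.supNorm lam) :
    ∀ (β : ℝ) (lam : g.Loc) (ζ : g.Cut) (y y' : g.Site), 0 ≤ β → β < 1 → g.cutInT ζ y → g.suppIn lam y' →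
      K.h1 U lam β ζ ≤ b' β * (g.len y) ^ (1 - β) * g.cutH β ζ * Real.exp (-(δ₀ * g.dist y y')) * g.supNorm lam :=
  fun β lam ζ y y' hβ0 hβ1 hζ hs => (h β lam ζ y y' hβ0 hβ1 hζ hs).trans
    (mul_le_mul_of_nonneg_right (mul_le_mul_of_nonneg_right (mul_le_mul_of_nonneg_right
      (mul_le_mul_of_nonneg_right (hbb β hβ0 hβ1) (Real.rpow_nonneg (hlen y) _)) (hcutH β ζ)) (Real.exp_nonneg _)) (hN lam))

omit [Fintype g.Site] in
/-- weakening the constant of the (3.44) line. [folklore] -/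
private theorem line344_weaken {K : B9.KernelFamily g B} {U : B.Cfg} {b b' : ℝ → ℝ} {δ₀ : ℝ}
    (hbb : ∀ ε, 0 < ε → ε ≤ 1 → b ε ≤ b' ε) (hhs : ∀ (ε : ℝ) (lam : g.Loc), 0 ≤ g.holder ε lam + g.supNorm lam)
    (h : ∀ (ε : ℝ) (lam : g.Loc) (y y' : g.Site), 0 < ε → ε ≤ 1 → g.suppInT lam y' →
      K.e4 U lam y ≤ b ε * Real.exp (-(δ₀ * g.dist y y')) * (g.holder ε lam + g.supNorm lam)) :
    ∀ (ε : ℝ) (lam : g.Loc) (y y' : g.Site), 0 < ε → ε ≤ 1 → g.suppInT lam y' →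
      K.e4 U lam y ≤ b' ε * Real.exp (-(δ₀ * g.dist y y')) * (g.holder ε lam + g.supNorm lam) :=
  fun ε lam y y' hε0 hε1 hs => (h ε lam y y' hε0 hε1 hs).trans
    (mul_le_mul_of_nonneg_right (mul_le_mul_of_nonneg_right (hbb ε hε0 hε1) (Real.exp_nonneg _)) (hhs ε lam))

omit [Fintype g.Site] in
/-- weakening the constant of the (3.45) line. [folklore] -/
private theorem line345_weaken {K : B9.KernelFamily g B} {U : B.Cfg} {b b' : ℝ → ℝ → ℝ} {δ₀ : ℝ}
    (hbb : ∀ ε β, 0 < ε → ε ≤ 1 → 0 ≤ β → β < 1 → b ε β ≤ b' ε β) (hlen : ∀ y : g.Site, 0 ≤ g.len y)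
    (hcutH : ∀ (β : ℝ) (ζ : g.Cut), 0 ≤ g.cutH β ζ) (hhs : ∀ (ε : ℝ) (lam : g.Loc), 0 ≤ g.holder ε lam + g.supNorm lam)
    (h : ∀ (ε β : ℝ) (lam : g.Loc) (ζ : g.Cut) (y y' : g.Site), 0 < ε → ε ≤ 1 → 0 ≤ β → β < 1 →
      g.cutInT ζ y → g.suppInT lam y' →
      K.h2 U lam β ζ ≤ b ε β * (g.len y) ^ (-β) * g.cutH β ζ * Real.exp (-(δ₀ * g.dist y y')) *
        (g.holder (β + ε) lam + g.supNorm lam)) :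
    ∀ (ε β : ℝ) (lam : g.Loc) (ζ : g.Cut) (y y' : g.Site), 0 < ε → ε ≤ 1 → 0 ≤ β → β < 1 →
      g.cutInT ζ y → g.suppInT lam y' →
      K.h2 U lam β ζ ≤ b' ε β * (g.len y) ^ (-β) * g.cutH β ζ * Real.exp (-(δ₀ * g.dist y y')) *
        (g.holder (β + ε) lam + g.supNorm lam) :=
  fun ε β lam ζ y y' hε0 hε1 hβ0 hβ1 hζ hs => (h ε β lam ζ y y' hε0 hε1 hβ0 hβ1 hζ hs).trans
    (mul_le_mul_of_nonneg_right (mul_le_mul_of_nonneg_right (mul_le_mul_of_nonneg_right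
      (mul_le_mul_of_nonneg_right (hbb ε β hε0 hε1 hβ0 hβ1) (Real.rpow_nonneg (hlen y) _)) (hcutH β ζ)) (Real.exp_nonneg _))
      (hhs (β + ε) lam))

/-- a probe majorant of the printed shape with a larger constant and a slower rate (twin of the sibling's private `probeMaj_mono`).
[folklore] -/
private theorem probeMaj_mono' {W Z : Type} (blkW : W → g.Site) (blkZ : Z → g.Site) {T : (W → ℝ) →ₗ[ℝ] (Z → ℝ)}
    {c c' δ δ' β : ℝ} (h : HasMajorantHom (g := toB6 g R H) blkW blkZ T
      (fun (a b : g.Site) => c * g.len a ^ (1 - β) * Real.exp (-(δ * g.dist a b))))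
    (hcc' : c ≤ c') (hδ : δ' ≤ δ) (hdnn : ∀ a b : g.Site, 0 ≤ g.dist a b)
    (hlen : ∀ y : g.Site, 0 ≤ g.len y) (hc : 0 ≤ c) :
    HasMajorantHom (g := toB6 g R H) blkW blkZ T
      (fun (a b : g.Site) => c' * g.len a ^ (1 - β) * Real.exp (-(δ' * g.dist a b))) := by
  refine hasMajorantHom_mono (g := toB6 g R H) blkW blkZ h fun a b => ?_
  have hW : 0 ≤ g.len a ^ (1 - β) := Real.rpow_nonneg (hlen a) _
  have hexp : Real.exp (-(δ * g.dist a b)) ≤ Real.exp (-(δ' * g.dist a b)) :=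
    Real.exp_le_exp.mpr (neg_le_neg (mul_le_mul_of_nonneg_right hδ (hdnn a b)))
  exact mul_le_mul (mul_le_mul_of_nonneg_right hcc' hW) hexp (Real.exp_nonneg _)
    (mul_nonneg (hc.trans hcc') hW)

omit [Fintype g.Site] in
/-- the six L² lines from the lines 0, 1, 2, 3, 4, 5. [folklore] -/
private theorem l2lines_of_six {K : B9.KernelFamily g B} {U : B.Cfg} {B₀ δ₀ : ℝ}
    (h0 : ∀ (lam : g.Loc) (h : g.Cut) (y y' : g.Site), g.cutIn h y → g.suppIn lam y' →
        K.l2 0 U lam h ≤ B₀ * B9.pref6 (g.len y) 0 * g.cutSup h * Real.exp (-(δ₀ * g.dist y y')) * g.l2Norm lam)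
    (h1 : ∀ (lam : g.Loc) (h : g.Cut) (y y' : g.Site), g.cutIn h y → g.suppIn lam y' →
        K.l2 1 U lam h ≤ B₀ * B9.pref6 (g.len y) 1 * g.cutSup h * Real.exp (-(δ₀ * g.dist y y')) * g.l2Norm lam)
    (h2 : ∀ (lam : g.Loc) (h : g.Cut) (y y' : g.Site), g.cutIn h y → g.suppIn lam y' →
        K.l2 2 U lam h ≤ B₀ * B9.pref6 (g.len y) 2 * g.cutSup h * Real.exp (-(δ₀ * g.dist y y')) * g.l2Norm lam)
    (h3 : ∀ (lam : g.Loc) (h : g.Cut) (y y' : g.Site), g.cutIn h y → g.suppIn lam y' →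
        K.l2 3 U lam h ≤ B₀ * B9.pref6 (g.len y) 3 * g.cutSup h * Real.exp (-(δ₀ * g.dist y y')) * g.l2Norm lam)
    (h4 : ∀ (lam : g.Loc) (h : g.Cut) (y y' : g.Site), g.cutIn h y → g.suppIn lam y' →
        K.l2 4 U lam h ≤ B₀ * B9.pref6 (g.len y) 4 * g.cutSup h * Real.exp (-(δ₀ * g.dist y y')) * g.l2Norm lam)
    (h5 : ∀ (lam : g.Loc) (h : g.Cut) (y y' : g.Site), g.cutIn h y → g.suppIn lam y' →
        K.l2 5 U lam h ≤ B₀ * B9.pref6 (g.len y) 5 * g.cutSup h * Real.exp (-(δ₀ * g.dist y y')) * g.l2Norm lam) :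
    ∀ (n : Fin 6) (lam : g.Loc) (h : g.Cut) (y y' : g.Site), g.cutIn h y → g.suppIn lam y' →
      K.l2 n U lam h ≤ B₀ * B9.pref6 (g.len y) n * g.cutSup h * Real.exp (-(δ₀ * g.dist y y')) * g.l2Norm lam := by
  intro n
  fin_cases n
  · exact h0
  · exact h1
  · exact h2
  · exact h3
  · exact h4
  · exact h5

end Helpers

/-! ## §1 ★ All blocks of Theorems 3.1 ∕ 3.3 for a kernel family, (3.43)–(3.46) read ON THE NEIGHBOURHOOD, at one member and one U -/

section OneMember

variable {g : B9.Geometry} [Fintype g.Site] [DecidableEq g.Site] {R : ℝ} {H : Prop} {B : B9.Backgrounds}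
variable {X Y PX PY : Type} [Fintype X] [Fintype Y] [Fintype PY]

/-- ★ **THE TYPED CONCLUSION OF THEOREM 3.1 ∕ 3.3 FOR A KERNEL FAMILY `K` AT `U`, EVERY MEMBER PROVED, FROM THE OPERATOR-LEVEL
MAJORANTS, THE RELATIVE (3.42) CO-READINGS AND THE NEIGHBOURHOOD-SITED (3.43)–(3.46) CO-READINGS** (the `Nbr` form of
`B9RWSumsAllBlocksRel.allIneqs_of_majorants_rel`; p. 410 ∕ p. 416: *"all the inequalities (3.42)–(3.47) hold"*).  Inputs at one member and
one U: the four sup majorants (C, δ) of A₀ = G, A₁ = ∇_UG, A₂ = G∇\*_U, A₃ = Δ_UG; the operator-level majorants of the remaining members — the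
probe majorants of Φ^Y_β∘A₁ and Φ^X_β∘A₂ (B_h(β), δ), the scale-weighted majorant of A₅ = GΔ_U (K₅, δ₅), the input block-norm majorants of
A₄ = ∇_UG∇\*_U (K₄₄(ε), K₄₅(ε, β), (1 − α)δ) and its L² block bound (K₄, (1 − 2α)δ); the transpose letters; the co-readings `CoRealizesRel`
(n06-l), `GlobReads`, `L2ReadsNbr`, `H1ReadsNbr`, `InputReadsNbr` (class multiplicity ≦ m, Lʲη and d saturated on classes; observation radius
r with neighbourhood count ≦ mN, level comparability CL, evaluation constant Cev); the member facts; the signs; and the constants' relations: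
m·C ≦ B₀, C·c₁(1 − α)·L₀⁴ ≦ B₀, mN·m·Cev·CL²·e^{rδ₀}·C·L₀ ≦ B₀, mN·m·Cev·CL²·e^{rδ₀}·√(CK₅)·L₀ ≦ B₀, mN·m·Cev·CL²·e^{rδ₀}·K₄ ≦ B₀,
m·CL·e^{rδ₀}·B_h(β) ≦ B(β), e^{rδ₀}·K₄₄(ε) ≦ B′(ε), CL·e^{rδ₀}·K₄₅(ε, β) ≦ B′(ε, β); rates 0 ≦ δ₀ ≦ (1 − 2α)δ ≦ (1 − α)δ ≦ δ ≦ δ₅.  Output: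
`B9.Ineq342_346_347 K B₀ δ₀ U ∧ B9.Ineq343_345 K Bβ Bε Bεβ δ₀ U`. [cite: Balaban1985BackgroundPropagators, Thm 3.1 ∕ 3.3 (3.42)–(3.47) pp.397–399 + Thm 3.7 ⇒ Thm 3.1 p.410 + Thm 3.10 ⇒ Thm 3.3 p.416; Balaban1984PropagatorsII, (2.51)–(2.52) p.232 + Lemma 2.1 p.234] -/
theorem allIneqs_of_majorants_nbr {K : B9.KernelFamily g B} {U : B.Cfg} (𝔭 : HolderProbes g B X Y PX PY)
    (bH : ℝ → BlockNorm (toB6 g R H) (Y → ℝ)) (blk : X → g.Site) (blkY : Y → g.Site)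
    (ev : g.Loc → X → ℝ) (evY : g.Loc → Y → ℝ)
    {A0 A3 A5 : Module.End ℝ (X → ℝ)} {A1 : (X → ℝ) →ₗ[ℝ] (Y → ℝ)} {A2 : (Y → ℝ) →ₗ[ℝ] (X → ℝ)}
    {A4 : Module.End ℝ (Y → ℝ)}
    (Rel : g.Site → g.Site → Prop) [DecidableRel Rel] (m : ℕ) (r Cev CL : ℝ) (mN : ℕ)
    (hRlen : ∀ a a', Rel a a' → g.len a = g.len a') (hRd₁ : ∀ a a' b, Rel a a' → g.dist a b = g.dist a' b)
    (hRd₂ : ∀ a b b', Rel b b' → g.dist a b = g.dist a b')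
    (hmult : ∀ y' : g.Site, (Finset.univ.filter (fun y'' => Rel y'' y')).card ≤ m)
    (hnbr : ∀ y : g.Site, (nbr g r y).card ≤ mN) (hCL1 : 1 ≤ CL)
    (hCLcmp : ∀ a a' : g.Site, g.dist a a' ≤ r → g.len a ≤ CL * g.len a')
    (htri : ∀ a b c : g.Site, g.dist a c ≤ g.dist a b + g.dist b c) (hCev : 0 ≤ Cev)
    {d : ℕ} {C δ α L₀ B₀ δ₀ K₄ K₅ δ₅ : ℝ} {Bh Bβ Bε K44 : ℝ → ℝ} {Bεβ K45 : ℝ → ℝ → ℝ}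
    (h0 : HasMajorant (g := toB6 g R H) blk A0 (fun (a b : g.Site) => C * g.len a ^ 2 * Real.exp (-(δ * g.dist a b))))
    (h1 : HasMajorantHom (g := toB6 g R H) blk blkY A1 (fun (a b : g.Site) => C * g.len a * Real.exp (-(δ * g.dist a b))))
    (h2 : HasMajorantHom (g := toB6 g R H) blkY blk A2 (fun (a b : g.Site) => C * g.len a * Real.exp (-(δ * g.dist a b))))
    (h3 : HasMajorantHom (g := toB6 g R H) blk blk A3 (fun (a b : g.Site) => C * Real.exp (-(δ * g.dist a b))))
    (hH : ∀ β : ℝ, 0 ≤ β → β < 1 →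
      HasMajorantHom (g := toB6 g R H) blk 𝔭.blkPY (𝔭.ΦY U β ∘ₗ A1)
          (fun (a b : g.Site) => Bh β * g.len a ^ (1 - β) * Real.exp (-(δ * g.dist a b))) ∧
        HasMajorantHom (g := toB6 g R H) blkY 𝔭.blkPX (𝔭.ΦX U β ∘ₗ A2)
          (fun (a b : g.Site) => Bh β * g.len a ^ (1 - β) * Real.exp (-(δ * g.dist a b))))
    (h5 : HasMajorantHom (g := toB6 g R H) blk blk A5
      (fun (a b : g.Site) => K₅ * (g.len a * (g.len b)⁻¹) * Real.exp (-(δ₅ * g.dist a b))))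
    (h44 : ∀ ε : ℝ, 0 < ε → ε ≤ 1 → HasMaj (bH ε) (BlockNorm.ofBlocks (toB6 g R H) blkY) A4
      (fun (a b : g.Site) => K44 ε * Real.exp (-((1 - α) * δ * g.dist a b))))
    (h45 : ∀ ε β : ℝ, 0 < ε → ε ≤ 1 → 0 ≤ β → β < 1 →
      HasMaj (bH (β + ε)) (BlockNorm.ofBlocks (toB6 g R H) 𝔭.blkPY) (𝔭.ΦY U β ∘ₗ A4)
        (fun (a b : g.Site) => K45 ε β * g.len a ^ (-β) * Real.exp (-((1 - α) * δ * g.dist a b))))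
    (hb4 : BlockBd (g := toB6 g R H) blkY blkY A4 (fun (a b : g.Site) => K₄ * Real.exp (-((1 - 2 * α) * δ * g.dist a b))))
    (hsym : IsTransposePair A0 A0) (htr : IsTransposePair A1 A2) (hadj : IsTransposePair A3 A5)
    (hco0 : CoRealizesRel K 0 U Rel blk blk ev A0) (hco1 : CoRealizesRel K 1 U Rel blkY blk ev A1)
    (hco2 : CoRealizesRel K 2 U Rel blk blkY evY A2) (hco3 : CoRealizesRel K 3 U Rel blk blk ev A3)
    (hgl0 : GlobReads K 0 U blk blk ev A0) (hgl1 : GlobReads K 1 U blkY blk ev A1)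
    (hgl2 : GlobReads K 2 U blk blkY evY A2) (hgl3 : GlobReads K 3 U blk blk ev A3)
    (hl0 : L2ReadsNbr (R := R) (H := H) K 0 U Rel r Cev blk blk ev A0)
    (hl1 : L2ReadsNbr (R := R) (H := H) K 1 U Rel r Cev blkY blk ev A1)
    (hl2 : L2ReadsNbr (R := R) (H := H) K 2 U Rel r Cev blk blkY evY A2)
    (hl3 : L2ReadsNbr (R := R) (H := H) K 3 U Rel r Cev blk blk ev A3)
    (hl4 : L2ReadsNbr (R := R) (H := H) K 4 U Rel r Cev blkY blkY evY A4)
    (hl5 : L2ReadsNbr (R := R) (H := H) K 5 U Rel r Cev blk blk ev A5)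
    (hH1 : H1ReadsNbr K U 𝔭 Rel r blk blkY ev evY A1 A2) (hIR : InputReadsNbr K U 𝔭 bH r blkY evY A4)
    (hF : Facts347 g R H d δ α L₀) (hsymm : ∀ y y' : g.Site, g.dist y y' = g.dist y' y)
    (hdnn : ∀ a b : g.Site, 0 ≤ g.dist a b) (hlen : ∀ y : g.Site, 0 < g.len y)
    (hC : 0 ≤ C) (hK₅ : 0 ≤ K₅) (hK₄ : 0 ≤ K₄) (hBh : ∀ β, 0 ≤ β → β < 1 → 0 ≤ Bh β)
    (hK44 : ∀ ε, 0 < ε → ε ≤ 1 → 0 ≤ K44 ε) (hK45 : ∀ ε β, 0 < ε → ε ≤ 1 → 0 ≤ β → β < 1 → 0 ≤ K45 ε β)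
    (hα : 0 ≤ α * δ) (hδ₀nn : 0 ≤ δ₀) (hδ₀ : δ₀ ≤ (1 - α) * δ) (hδ₀2 : δ₀ ≤ (1 - 2 * α) * δ) (hδ₅ : δ ≤ δ₅)
    (hCB : (m : ℝ) * C ≤ B₀) (hCg : C * B6.c1 d δ (1 - α) * L₀ ^ (4 : ℝ) ≤ B₀)
    (hCL : (mN : ℝ) * m * Cev * CL ^ 2 * Real.exp (r * δ₀) * (C * L₀) ≤ B₀)
    (hB5 : (mN : ℝ) * m * Cev * CL ^ 2 * Real.exp (r * δ₀) * (Real.sqrt (C * K₅) * L₀) ≤ B₀)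
    (hB4 : (mN : ℝ) * m * Cev * CL ^ 2 * Real.exp (r * δ₀) * K₄ ≤ B₀)
    (hBβ : ∀ β, 0 ≤ β → β < 1 → (m : ℝ) * CL * Real.exp (r * δ₀) * Bh β ≤ Bβ β)
    (hBε : ∀ ε, 0 < ε → ε ≤ 1 → Real.exp (r * δ₀) * K44 ε ≤ Bε ε)
    (hBεβ : ∀ ε β, 0 < ε → ε ≤ 1 → 0 ≤ β → β < 1 → CL * Real.exp (r * δ₀) * K45 ε β ≤ Bεβ ε β) :
    B9.Ineq342_346_347 K B₀ δ₀ U ∧ B9.Ineq343_345 K Bβ Bε Bεβ δ₀ U := by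
  have hlen0 : ∀ y : g.Site, 0 ≤ g.len y := fun y => (hlen y).le
  have hm : (0 : ℝ) ≤ m := Nat.cast_nonneg m
  have hmC : 0 ≤ (m : ℝ) * C := mul_nonneg hm hC
  have hB₀ : 0 ≤ B₀ := hmC.trans hCB
  have hδ₀' : δ₀ ≤ δ := hδ₀.trans (by nlinarith [hα])
  have hN : ∀ lam : g.Loc, 0 ≤ g.supNorm lam := hco0.norm_nonneg
  have hL₀ : 0 ≤ L₀ := le_trans (le_trans zero_le_one hF.one_le_L) hF.L_le
  have hexp : ∀ a b : g.Site, Real.exp (-((1 - α) * δ * g.dist a b)) ≤ Real.exp (-(δ₀ * g.dist a b)) := fun a b =>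
    Real.exp_le_exp.mpr (neg_le_neg (mul_le_mul_of_nonneg_right hδ₀ (hdnn a b)))
  have hexp2 : ∀ a b : g.Site, Real.exp (-((1 - 2 * α) * δ * g.dist a b)) ≤ Real.exp (-(δ₀ * g.dist a b)) := fun a b =>
    Real.exp_le_exp.mpr (neg_le_neg (mul_le_mul_of_nonneg_right hδ₀2 (hdnn a b)))
  -- saturation of the printed (3.42) majorants on the classes
  have hsat₁ : ∀ (n : Fin 4) (a a' b : g.Site), Rel a a' → maj342 g n C δ a b = maj342 g n C δ a' b :=
    fun n a a' b hr => by simp only [maj342]; rw [hRlen a a' hr, hRd₁ a a' b hr]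
  have hsat₂ : ∀ (n : Fin 4) (a b b' : g.Site), Rel b b' → maj342 g n C δ a b = maj342 g n C δ a b' :=
    fun n a b b' hr => by simp only [maj342]; rw [hRd₂ a b b' hr]
  have hm0 : HasMajorantHom (g := toB6 g R H) blk blk A0 (maj342 g 0 C δ) := by
    rw [maj342_zero]; exact (hasMajorantHom_iff (g := toB6 g R H) blk A0 _).mpr h0
  have hm1 : HasMajorantHom (g := toB6 g R H) blk blkY A1 (maj342 g 1 C δ) := by rw [maj342_one]; exact h1
  have hm2 : HasMajorantHom (g := toB6 g R H) blkY blk A2 (maj342 g 2 C δ) := by rw [maj342_two]; exact h2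
  have hm3 : HasMajorantHom (g := toB6 g R H) blk blk A3 (maj342 g 3 C δ) := by rw [maj342_three]; exact h3
  -- (3.42): n06-l's engine, constant m·C at rate δ, merged to (B₀, δ₀)
  have h342C : ∀ n : Fin 4, Clause342 K n (m * C) δ U :=
    clause342_all (clause342_of_hasMajorantHom_rel hco0 hC hlen0 (hsat₁ 0) (hsat₂ 0) hmult hm0)
      (clause342_of_hasMajorantHom_rel hco1 hC hlen0 (hsat₁ 1) (hsat₂ 1) hmult hm1)
      (clause342_of_hasMajorantHom_rel hco2 hC hlen0 (hsat₁ 2) (hsat₂ 2) hmult hm2)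
      (clause342_of_hasMajorantHom_rel hco3 hC hlen0 (hsat₁ 3) (hsat₂ 3) hmult hm3)
  have h342 : ∀ n : Fin 4, Clause342 K n B₀ δ₀ U := fun n =>
    clause342_mono (h342C n) hmC hCB hδ₀' hdnn hlen0 hN
  -- (3.47): the four weighted lines from the sup majorants (no fibre field — unchanged)
  have h347 : ∀ (n : Fin 4) (lam : g.Loc) (γ : ℝ), -4 ≤ γ → γ ≤ 4 → K.glob n U lam γ ≤ B₀ * g.wNorm γ lam := by
    intro n lam γ hγ₁ hγ₂
    have hw : ∀ (hg : 0 ≤ g.wNorm γ lam), K.glob n U lam γ ≤ C * B6.c1 d δ (1 - α) * L₀ ^ (4 : ℝ) * g.wNorm γ lam →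
        K.glob n U lam γ ≤ B₀ * g.wNorm γ lam := fun hg h =>
      h.trans (mul_le_mul_of_nonneg_right hCg hg)
    fin_cases n
    · exact hw (hgl0.wnorm_nonneg lam γ) (glob_of_majorant hF hgl0 hC hm0 lam γ hγ₁ hγ₂)
    · exact hw (hgl1.wnorm_nonneg lam γ) (glob_of_majorant hF hgl1 hC hm1 lam γ hγ₁ hγ₂)
    · exact hw (hgl2.wnorm_nonneg lam γ) (glob_of_majorant hF hgl2 hC hm2 lam γ hγ₁ hγ₂)
    · exact hw (hgl3.wnorm_nonneg lam γ) (glob_of_majorant hF hgl3 hC hm3 lam γ hγ₁ hγ₂)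
  -- (3.46)₀,₁,₂: the Schur block bounds of the sibling at (C·L₀, (1−α)δ), merged to rate δ₀, read on the neighbourhood
  have hmono : ∀ (P : g.Site → ℝ) (c : ℝ), 0 ≤ c → (∀ y, 0 ≤ P y) → ∀ y y' : g.Site,
      c * P y * Real.exp (-((1 - α) * δ * g.dist y y')) ≤ c * P y * Real.exp (-(δ₀ * g.dist y y')) :=
    fun P c hc hP y y' => mul_le_mul_of_nonneg_left (hexp y y') (mul_nonneg hc (hP y))
  have hCL0 : 0 ≤ C * L₀ := mul_nonneg hC hL₀
  have p012 : ∀ t : ℝ, B9.pref6 t 0 = t ^ 2 ∧ B9.pref6 t 1 = t ∧ B9.pref6 t 2 = t := fun t => by simp [B9.pref6]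
  have hb0 : BlockBd (g := toB6 g R H) blk blk A0
      (fun (y y' : g.Site) => C * L₀ * B9.pref6 (g.len y) 0 * Real.exp (-(δ₀ * g.dist y y'))) := by
    refine (blockBd_entry0 hF hC hsymm hlen blk h0 hsym).mono fun y y' => ?_
    rw [(p012 (g.len y)).1]
    exact hmono (fun y => g.len y ^ 2) (C * L₀) hCL0 (fun y => sq_nonneg _) y y'
  have hb1 : BlockBd (g := toB6 g R H) blk blkY A1
      (fun (y y' : g.Site) => C * L₀ * B9.pref6 (g.len y) 1 * Real.exp (-(δ₀ * g.dist y y'))) := by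
    refine (blockBd_entry1 hF hC hsymm hlen blk blkY h1 h2 htr).mono fun y y' => ?_
    rw [(p012 (g.len y)).2.1]
    exact hmono (fun y => g.len y) (C * L₀) hCL0 hlen0 y y'
  have hb2 : BlockBd (g := toB6 g R H) blkY blk A2
      (fun (y y' : g.Site) => C * L₀ * B9.pref6 (g.len y) 2 * Real.exp (-(δ₀ * g.dist y y'))) := by
    refine (blockBd_entry2 hF hC hsymm hlen blk blkY h1 h2 htr).mono fun y y' => ?_
    rw [(p012 (g.len y)).2.2]
    exact hmono (fun y => g.len y) (C * L₀) hCL0 hlen0 y y'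
  have hl20 := l2line_weaken hCL hlen0 hl0.cutSup_nonneg hl0.l2norm_nonneg
    (l2line_of_blockBd_nbr hl0 hRd₂ hmult hnbr hCL1 hCLcmp htri hsymm hCL0 hδ₀nn hCev hlen0 hb0)
  have hl21 := l2line_weaken hCL hlen0 hl1.cutSup_nonneg hl1.l2norm_nonneg
    (l2line_of_blockBd_nbr hl1 hRd₂ hmult hnbr hCL1 hCLcmp htri hsymm hCL0 hδ₀nn hCev hlen0 hb1)
  have hl22 := l2line_weaken hCL hlen0 hl2.cutSup_nonneg hl2.l2norm_nonneg
    (l2line_of_blockBd_nbr hl2 hRd₂ hmult hnbr hCL1 hCLcmp htri hsymm hCL0 hδ₀nn hCev hlen0 hb2)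
  -- (3.46)₃,₅: the Schur test for the transposed pair (Δ_UG, GΔ_U)
  have hSK : 0 ≤ Real.sqrt (C * K₅) * L₀ := mul_nonneg (Real.sqrt_nonneg _) hL₀
  obtain ⟨hb3, hb5⟩ := blockBd_pair_of_transpose hF hC hK₅ hsymm hdnn hlen hδ₅ blk h3 h5 hadj
  have hb3' : BlockBd (g := toB6 g R H) blk blk A3
      (fun (y y' : g.Site) => Real.sqrt (C * K₅) * L₀ * B9.pref6 (g.len y) 3 * Real.exp (-(δ₀ * g.dist y y'))) :=
    hb3.mono fun y y' => hmono (fun y => B9.pref6 (g.len y) 3) _ hSK (fun y => B9FromB6.pref6_nonneg (hlen0 y) 3) y y'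
  have hb5' : BlockBd (g := toB6 g R H) blk blk A5
      (fun (y y' : g.Site) => Real.sqrt (C * K₅) * L₀ * B9.pref6 (g.len y) 5 * Real.exp (-(δ₀ * g.dist y y'))) :=
    hb5.mono fun y y' => hmono (fun y => B9.pref6 (g.len y) 5) _ hSK (fun y => B9FromB6.pref6_nonneg (hlen0 y) 5) y y'
  have hl23 := l2line_weaken hB5 hlen0 hl3.cutSup_nonneg hl3.l2norm_nonneg
    (l2line_of_blockBd_nbr hl3 hRd₂ hmult hnbr hCL1 hCLcmp htri hsymm hSK hδ₀nn hCev hlen0 hb3')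
  have hl25 := l2line_weaken hB5 hlen0 hl5.cutSup_nonneg hl5.l2norm_nonneg
    (l2line_of_blockBd_nbr hl5 hRd₂ hmult hnbr hCL1 hCLcmp htri hsymm hSK hδ₀nn hCev hlen0 hb5')
  -- (3.46)₄: the two-sided L² block bound
  have hb4' : BlockBd (g := toB6 g R H) blkY blkY A4
      (fun (y y' : g.Site) => K₄ * B9.pref6 (g.len y) 4 * Real.exp (-(δ₀ * g.dist y y'))) := by
    refine hb4.mono fun a b => ?_
    rw [pref6_four, mul_one]
    exact mul_le_mul_of_nonneg_left (hexp2 a b) hK₄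
  have hl24 := l2line_weaken hB4 hlen0 hl4.cutSup_nonneg hl4.l2norm_nonneg
    (l2line_of_blockBd_nbr hl4 hRd₂ hmult hnbr hCL1 hCLcmp htri hsymm hK₄ hδ₀nn hCev hlen0 hb4')
  have h346 := l2lines_of_six hl20 hl21 hl22 hl23 hl24 hl25
  -- (3.43): the probe majorants at (B_h, δ₀), read on the neighbourhood (×m·CL·e^{rδ₀}), merged to B(β)
  have hLβ : ∀ β, 0 ≤ β → β < 1 → HasMajorantHom (g := toB6 g R H) blk 𝔭.blkPY (𝔭.ΦY U β ∘ₗ A1)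
      (fun (a b : g.Site) => Bh β * g.len a ^ (1 - β) * Real.exp (-(δ₀ * g.dist a b))) := fun β hβ0 hβ1 =>
    probeMaj_mono' blk 𝔭.blkPY (hH β hβ0 hβ1).1 le_rfl hδ₀' hdnn hlen0 (hBh β hβ0 hβ1)
  have hRβ : ∀ β, 0 ≤ β → β < 1 → HasMajorantHom (g := toB6 g R H) blkY 𝔭.blkPX (𝔭.ΦX U β ∘ₗ A2)
      (fun (a b : g.Site) => Bh β * g.len a ^ (1 - β) * Real.exp (-(δ₀ * g.dist a b))) := fun β hβ0 hβ1 =>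
    probeMaj_mono' blkY 𝔭.blkPX (hH β hβ0 hβ1).2 le_rfl hδ₀' hdnn hlen0 (hBh β hβ0 hβ1)
  have h343 := line343_weaken hBβ hlen0 hH1.cutH_nonneg hH1.norm_nonneg
    (line343_of_hasMajorantHom_nbr (R := R) (H := H) hH1 hRd₂ hmult hCL1 hCLcmp htri hsymm hBh hδ₀nn hlen0 hLβ hRβ)
  -- (3.44)∕(3.45): the input majorants merged to rate δ₀, read on the neighbourhood, constants merged to B′(ε), B′(ε,β)
  have h44' : ∀ ε, 0 < ε → ε ≤ 1 → HasMaj (bH ε) (BlockNorm.ofBlocks (toB6 g R H) blkY) A4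
      (fun (a b : g.Site) => K44 ε * Real.exp (-(δ₀ * g.dist a b))) :=
    fun ε hε0 hε1 => (h44 ε hε0 hε1).mono fun a b => mul_le_mul_of_nonneg_left (hexp a b) (hK44 ε hε0 hε1)
  have h45' : ∀ ε β, 0 < ε → ε ≤ 1 → 0 ≤ β → β < 1 →
      HasMaj (bH (β + ε)) (BlockNorm.ofBlocks (toB6 g R H) 𝔭.blkPY) (𝔭.ΦY U β ∘ₗ A4)
        (fun (a b : g.Site) => K45 ε β * g.len a ^ (-β) * Real.exp (-(δ₀ * g.dist a b))) := by
    intro ε β hε0 hε1 hβ0 hβ1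
    refine (h45 ε β hε0 hε1 hβ0 hβ1).mono fun a b => ?_
    exact mul_le_mul_of_nonneg_left (hexp a b) (mul_nonneg (hK45 ε β hε0 hε1 hβ0 hβ1) (Real.rpow_nonneg (hlen0 a) _))
  obtain ⟨h344K, h345K⟩ := lines3445_of_hasMaj_nbr hIR hCL1 hCLcmp htri hsymm hK44 hK45 hδ₀nn hlen h44' h45'
  have h344 := line344_weaken hBε hIR.hs_nonneg h344K
  have h345 := line345_weaken hBεβ hlen0 hIR.cutH_nonneg hIR.hs_nonneg h345K
  exact ⟨ineq342_346_347_of_clauses h342 h346 h347, ineq343_345_of_lines h343 h344 h345⟩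

end OneMember

/-! ## §2 ★★ Theorem 3.10 (the sum G(U) of (3.107)) at the all-blocks pin with NO displayed residual, neighbourhood-sited readings -/

section AllPinsG

variable {I : Type} {c35 : ℝ} {geo : I → B9.Geometry} {bg : I → B9.Backgrounds}
variable [∀ i, Fintype (geo i).Site] [∀ i, DecidableEq (geo i).Site]

/-- Arithmetic of «for M sufficiently large»: M ≧ 2N_Fθ₀c₁ gives N_F·θ₀M⁻¹·c₁ ≦ ½ (twin of the siblings' private lemma). [folklore] -/
private theorem small_of_threshold_nbr {NF θ₀ c M : ℝ} (hM : 0 < M) (hbig : 2 * NF * θ₀ * c ≤ M) :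
    NF * (θ₀ * M⁻¹) * c ≤ 1 / 2 := by
  have h1 : NF * (θ₀ * M⁻¹) * c = (NF * θ₀ * c) / M := by
    rw [div_eq_mul_inv]
    ring
  rw [h1, div_le_iff₀ hM]
  linarith

/-- ★★ **THEOREM 3.10 AT THE ALL-BLOCKS PIN WITH NO DISPLAYED RESIDUAL, THE (3.43)–(3.46) CO-READINGS SITED ON THE NEIGHBOURHOOD** — p. 416:
*"From (3.108) it follows that the expansion (3.107) is convergent in all norms in the inequalities (3.42)–(3.47). This implies Theorem 3.3."*
The `Nbr` form of `B9RWSumsAllBlocksRel.thm310Printed_allPin_completeRel` (whose class-sited `L2ReadsRel`∕`H1ReadsRel`∕`InputReadsRel` binders are not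
dischargeable at the record's coordinate pins — `B9RWSumsReadsRelNegative.not_l2ReadsRel_evBK`): the leaf `B9.Thm310Printed c35 geo bg (fun i =>
W310OfOps (𝔬 i) (rd i) (ConvAll3107 (𝔬 i) (R i) (H i) C δ (K i) B₀ δ₀ Bβ Bε Bεβ))` from the leaf at the sup-block pin (`h310`) and, per member
and per regular configuration, ONLY operator-level hypothesis schemas of printed shape about the local operators (`HolderLegs310`, `LapLegs310`,
`InputLegs310`, `L2TwoLegs310`), the elementary factors (`Factors389`, `FactorsHolder310`, `FactorsInput310`, `FactorsL2_310`), the structure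
(3.105) (`Identities310`), the static data, the letters, the member facts — and the co-readings of `K i` (`CoRealizesRel` relative to `Rel i` (n06-l),
`GlobReads`, and the NEIGHBOURHOOD-SITED `L2ReadsNbr`, `H1ReadsNbr`, `InputReadsNbr` of radius r) with class multiplicity ≦ m, Lʲη, d saturated
on classes, neighbourhood count ≦ mN, level comparability CL and evaluation constant Cev; the multiplicities are folded into the constants'
relations (m·C ≦ B₀, mN·m·Cev·CL²·e^{rδ₀}·C·L₀ ≦ B₀, mN·m·Cev·CL²·e^{rδ₀}·√(C·lapConst)·L₀ ≦ B₀, mN·m·Cev·CL²·e^{rδ₀}·twoConst ≦ B₀,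
m·CL·e^{rδ₀}·holderConst(β) ≦ B(β), e^{rδ₀}·inputConst44 ≦ B′(ε), CL·e^{rδ₀}·inputConst45 ≦ B′(ε,β)).  Every
member line is PROVED inside through the siblings' operator lemmas `holder343_of_local310`, `lap_of_local310`, `input3445_of_local310`,
`l2line4_of_local310`, `blockBd_entry0∕1∕2`, `blockBd_pair_of_transpose` and §1.  Nothing of print asserted; every input is a hypothesis;
NOT a node discharge. [cite: Balaban1985BackgroundPropagators, Thm 3.10 (3.105)–(3.108) pp.414–416 + Thm 3.3 p.399 + (3.42)–(3.47) pp.397–398 + Cor. 3.6 p.408 + p.413; Balaban1984PropagatorsII, (2.51)–(2.52) p.232 + Lemma 2.1 (2.60)–(2.61) p.234] -/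
theorem thm310Printed_allPin_completeNbr {X Y ι A PX PY : I → Type} [∀ i, Fintype (X i)] [∀ i, DecidableEq (X i)]
    [∀ i, Fintype (Y i)] [∀ i, DecidableEq (Y i)] [∀ i, Fintype (ι i)] [∀ i, Fintype (A i)] [∀ i, Fintype (PX i)]
    [∀ i, DecidableEq (PX i)] [∀ i, Fintype (PY i)] [∀ i, DecidableEq (PY i)]
    {𝔬 : ∀ i, Ops310 (geo i) (bg i) (X i) (Y i) (ι i) (A i)}
    {rd : ∀ i, WalkReading310 (geo i) (bg i) (X i) (ι i) (A i)} {R : I → ℝ} {H : I → Prop} {C δ : ℝ}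
    (𝔭 : ∀ i, HolderProbes (geo i) (bg i) (X i) (Y i) (PX i) (PY i))
    (bH : ∀ i, ℝ → BlockNorm (toB6 (geo i) (R i) (H i)) (Y i → ℝ))
    (K : ∀ i, B9.KernelFamily (geo i) (bg i)) (ev : ∀ i, (geo i).Loc → X i → ℝ) (evY : ∀ i, (geo i).Loc → Y i → ℝ)
    (Rel : ∀ i, (geo i).Site → (geo i).Site → Prop) [∀ i, DecidableRel (Rel i)] (m : ℕ) (r Cev CL : ℝ) (mN : ℕ)
    {d : ℕ} {α L₀ B₀ δ₀ Mg : ℝ} {Bβ Bε : ℝ → ℝ} {Bεβ : ℝ → ℝ → ℝ}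
    (κ : I → Sizes310) (SH : ∀ i, ι i → Finset (geo i).Site) (Bl θH : ℝ → ℝ) (d₁ : ℕ)
    (δ₁ α₁ ρ N N' NF Cℓ θ₀ NH a₁ M₁ ML : ℝ)
    (SL : ∀ i, ι i → Finset (geo i).Site) (NL BL MF : ℝ) (d₁' : ℕ)
    (SI : ∀ i, ι i → Finset (geo i).Site) (NI : ℝ) (BI θI : ℝ → ℝ) (BI2 : ℝ → ℝ → ℝ)
    (S2 : ∀ i, ι i → Finset (geo i).Site) (N2 B2 θ2 : ℝ)
    (h310 : B9.Thm310Printed c35 geo bg (fun i => W310OfOps (𝔬 i) (rd i) (Conv3107 (𝔬 i) (R i) (H i) C δ)))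
    (hRlen : ∀ i (a a' : (geo i).Site), Rel i a a' → (geo i).len a = (geo i).len a')
    (hRd₁ : ∀ i (a a' b : (geo i).Site), Rel i a a' → (geo i).dist a b = (geo i).dist a' b)
    (hRd₂ : ∀ i (a b b' : (geo i).Site), Rel i b b' → (geo i).dist a b = (geo i).dist a b')
    (hmult : ∀ i (y' : (geo i).Site), (Finset.univ.filter (fun y'' => Rel i y'' y')).card ≤ m)
    (hnbr : ∀ i (y : (geo i).Site), (nbr (geo i) r y).card ≤ mN) (hCL1 : 1 ≤ CL)
    (hCLcmp : ∀ i (a a' : (geo i).Site), (geo i).dist a a' ≤ r → (geo i).len a ≤ CL * (geo i).len a')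
    (htri : ∀ i (a b c : (geo i).Site), (geo i).dist a c ≤ (geo i).dist a b + (geo i).dist b c) (hCev : 0 ≤ Cev)
    (hco0 : ∀ i U, CoRealizesRel (K i) 0 U (Rel i) (𝔬 i).blk (𝔬 i).blk (ev i) ((𝔬 i).G U))
    (hco1 : ∀ i U, CoRealizesRel (K i) 1 U (Rel i) (𝔬 i).blkY (𝔬 i).blk (ev i) ((𝔬 i).D U ∘ₗ (𝔬 i).G U))
    (hco2 : ∀ i U, CoRealizesRel (K i) 2 U (Rel i) (𝔬 i).blk (𝔬 i).blkY (evY i) ((𝔬 i).G U ∘ₗ (𝔬 i).Dstar U))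
    (hco3 : ∀ i U, CoRealizesRel (K i) 3 U (Rel i) (𝔬 i).blk (𝔬 i).blk (ev i) ((𝔬 i).Lap U ∘ₗ (𝔬 i).G U))
    (hgl0 : ∀ i U, GlobReads (K i) 0 U (𝔬 i).blk (𝔬 i).blk (ev i) ((𝔬 i).G U))
    (hgl1 : ∀ i U, GlobReads (K i) 1 U (𝔬 i).blkY (𝔬 i).blk (ev i) ((𝔬 i).D U ∘ₗ (𝔬 i).G U))
    (hgl2 : ∀ i U, GlobReads (K i) 2 U (𝔬 i).blk (𝔬 i).blkY (evY i) ((𝔬 i).G U ∘ₗ (𝔬 i).Dstar U))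
    (hgl3 : ∀ i U, GlobReads (K i) 3 U (𝔬 i).blk (𝔬 i).blk (ev i) ((𝔬 i).Lap U ∘ₗ (𝔬 i).G U))
    (hl0 : ∀ i U, L2ReadsNbr (R := R i) (H := H i) (K i) 0 U (Rel i) r Cev (𝔬 i).blk (𝔬 i).blk (ev i) ((𝔬 i).G U))
    (hl1 : ∀ i U, L2ReadsNbr (R := R i) (H := H i) (K i) 1 U (Rel i) r Cev (𝔬 i).blkY (𝔬 i).blk (ev i) ((𝔬 i).D U ∘ₗ (𝔬 i).G U))
    (hl2 : ∀ i U, L2ReadsNbr (R := R i) (H := H i) (K i) 2 U (Rel i) r Cev (𝔬 i).blk (𝔬 i).blkY (evY i)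
      ((𝔬 i).G U ∘ₗ (𝔬 i).Dstar U))
    (hl3 : ∀ i U, L2ReadsNbr (R := R i) (H := H i) (K i) 3 U (Rel i) r Cev (𝔬 i).blk (𝔬 i).blk (ev i) ((𝔬 i).Lap U ∘ₗ (𝔬 i).G U))
    (hl4 : ∀ i U, L2ReadsNbr (R := R i) (H := H i) (K i) 4 U (Rel i) r Cev (𝔬 i).blkY (𝔬 i).blkY (evY i)
      ((𝔬 i).D U ∘ₗ ((𝔬 i).G U ∘ₗ (𝔬 i).Dstar U)))
    (hl5 : ∀ i U, L2ReadsNbr (R := R i) (H := H i) (K i) 5 U (Rel i) r Cev (𝔬 i).blk (𝔬 i).blk (ev i) ((𝔬 i).G U ∘ₗ (𝔬 i).Lap U))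
    (hH1 : ∀ i U, H1ReadsNbr (K i) U (𝔭 i) (Rel i) r (𝔬 i).blk (𝔬 i).blkY (ev i) (evY i) ((𝔬 i).D U ∘ₗ (𝔬 i).G U)
      ((𝔬 i).G U ∘ₗ (𝔬 i).Dstar U))
    (hIR : ∀ i U, InputReadsNbr (K i) U (𝔭 i) (bH i) r (𝔬 i).blkY (evY i)
      ((𝔬 i).D U ∘ₗ ((𝔬 i).G U ∘ₗ (𝔬 i).Dstar U)))
    (hsym : ∀ i U, IsTransposePair ((𝔬 i).G U) ((𝔬 i).G U))
    (htr : ∀ i U, IsTransposePair ((𝔬 i).D U ∘ₗ (𝔬 i).G U) ((𝔬 i).G U ∘ₗ (𝔬 i).Dstar U))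
    (hadjL : ∀ i U, IsTransposePair ((𝔬 i).Lap U ∘ₗ (𝔬 i).G U) ((𝔬 i).G U ∘ₗ (𝔬 i).Lap U))
    (hfacts : ∀ i, Mg ≤ (geo i).M → Facts347 (geo i) (R i) (H i) d δ α L₀)
    (hdsymm : ∀ i (a b : (geo i).Site), (geo i).dist a b = (geo i).dist b a)
    (hC : 0 ≤ C) (hCB : (m : ℝ) * C ≤ B₀) (hCL : (mN : ℝ) * m * Cev * CL ^ 2 * Real.exp (r * δ₀) * (C * L₀) ≤ B₀)
    (hδ₀nn : 0 ≤ δ₀) (hδ₀ : δ₀ ≤ (1 - α) * δ)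
    (hδ₀2 : δ₀ ≤ (1 - 2 * α) * δ) (hα : 0 ≤ α * δ) (hα2 : 2 * α * δ ≤ δ) (hCg : C * B6.c1 d δ (1 - α) * L₀ ^ (4 : ℝ) ≤ B₀)
    (hc : 0 < c35) (ha₁ : 0 < a₁) (hα₁ : 0 ≤ α₁) (hα₁2 : α₁ ≤ 1 / 2) (hNF : 0 ≤ NF) (hθ₀ : 0 ≤ θ₀) (hNH : 0 ≤ NH)
    (hδnn : 0 ≤ δ) (hδ5 : δ ≤ (1 - 2 * α₁) * δ₁) (hδ₁ : 0 ≤ δ₁) (hNL : 0 ≤ NL) (hBL : 0 ≤ BL) (hNI : 0 ≤ NI) (hN2 : 0 ≤ N2)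
    (hB2 : 0 ≤ B2) (hθ2 : 0 ≤ θ2)
    (hB5 : (mN : ℝ) * m * Cev * CL ^ 2 * Real.exp (r * δ₀) * (Real.sqrt (C * lapConst d₁ δ₁ α₁ NL BL L₀) * L₀) ≤ B₀)
    (hB4 : (mN : ℝ) * m * Cev * CL ^ 2 * Real.exp (r * δ₀) * twoConst d₁ δ₁ α₁ N2 B2 NF θ2 C L₀ ≤ B₀)
    (hst : ∀ i, StaticOK310 (𝔬 i) ρ N N' NF Cℓ (κ i))
    (hcntH : ∀ i (a : (geo i).Site), (∑ q, if a ∈ SH i q then (1 : ℝ) else 0) ≤ NH)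
    (hcntL : ∀ i (a : (geo i).Site), (∑ q, if a ∈ SL i q then (1 : ℝ) else 0) ≤ NL)
    (hcntI : ∀ i (a : (geo i).Site), (∑ q, if a ∈ SI i q then (1 : ℝ) else 0) ≤ NI)
    (hcnt2 : ∀ i (a : (geo i).Site), (∑ q, if a ∈ S2 i q then (1 : ℝ) else 0) ≤ N2)
    (hBl : ∀ β, 0 ≤ β → β < 1 → 0 ≤ Bl β) (hθH : ∀ β, 0 ≤ β → β < 1 → 0 ≤ θH β)
    (hBI : ∀ ε, 0 < ε → ε ≤ 1 → 0 ≤ BI ε) (hBI2 : ∀ ε β, 0 < ε → ε ≤ 1 → 0 ≤ β → β < 1 → 0 ≤ BI2 ε β)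
    (hθI : ∀ ε, 0 < ε → 0 ≤ θI ε)
    (hBβ : ∀ β, 0 ≤ β → β < 1 → (m : ℝ) * CL * Real.exp (r * δ₀) * holderConst d₁ δ₁ α₁ NH NF C (Bl β) (θH β) ≤ Bβ β)
    (hBε : ∀ ε, 0 < ε → ε ≤ 1 → Real.exp (r * δ₀) * inputConst44 d₁ δ₁ α₁ NI NF C L₀ (BI ε) (θI ε) ≤ Bε ε)
    (hBεβ : ∀ ε β, 0 < ε → ε ≤ 1 → 0 ≤ β → β < 1 →
      CL * Real.exp (r * δ₀) *
        inputConst45 d₁ δ₁ α₁ NI NF L₀ (holderConst d₁ δ₁ α₁ NH NF C (Bl β) (θH β)) (BI2 ε β) (θI (β + ε)) ≤ Bεβ ε β)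
    (h261 : ∀ i, ML ≤ (geo i).M → Ineq261 d₁ (toB6 (geo i) (R i) (H i)) δ₁ α₁)
    (hF₁ : ∀ i, MF ≤ (geo i).M → Facts347 (geo i) (R i) (H i) d₁' δ₁ α₁ L₀)
    (hop : ∀ i, M₁ ≤ (geo i).M → ∀ α₀ : ℝ, 0 < α₀ → c35 * (geo i).M * α₀ ≤ a₁ →
      ∀ U : (bg i).Cfg, (bg i).Reg335 c35 α₀ U →
        Factors389 (𝔬 i) (R i) (H i) θ₀ δ₁ U ∧ Identities310 (𝔬 i) (R i) (H i) U ∧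
          HolderLegs310 (𝔬 i) (𝔭 i) (R i) (H i) (SH i) Bl δ₁ U ∧ FactorsHolder310 (𝔬 i) (𝔭 i) (R i) (H i) θH δ₁ U)
    (hopL : ∀ i, M₁ ≤ (geo i).M → ∀ α₀ : ℝ, 0 < α₀ → c35 * (geo i).M * α₀ ≤ a₁ →
      ∀ U : (bg i).Cfg, (bg i).Reg335 c35 α₀ U → LapLegs310 (𝔬 i) (R i) (H i) (SL i) BL δ₁ U)
    (hopI : ∀ i, M₁ ≤ (geo i).M → ∀ α₀ : ℝ, 0 < α₀ → c35 * (geo i).M * α₀ ≤ a₁ →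
      ∀ U : (bg i).Cfg, (bg i).Reg335 c35 α₀ U →
        InputLegs310 (𝔬 i) (𝔭 i) (R i) (H i) (bH i) (SI i) BI BI2 δ₁ U ∧ FactorsInput310 (𝔬 i) (R i) (H i) (bH i) θI δ₁ U)
    (hop2 : ∀ i, M₁ ≤ (geo i).M → ∀ α₀ : ℝ, 0 < α₀ → c35 * (geo i).M * α₀ ≤ a₁ →
      ∀ U : (bg i).Cfg, (bg i).Reg335 c35 α₀ U →
        L2TwoLegs310 (𝔬 i) (R i) (H i) (S2 i) B2 δ₁ U ∧ FactorsL2_310 (𝔬 i) (R i) (H i) θ2 δ₁ U) :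
    B9.Thm310Printed c35 geo bg
      (fun i => W310OfOps (𝔬 i) (rd i) (ConvAll3107 (𝔬 i) (R i) (H i) C δ (K i) B₀ δ₀ Bβ Bε Bεβ)) := by
  have hαδ₁ : 0 ≤ α₁ * δ₁ := mul_nonneg hα₁ hδ₁
  have hrate : (1 - 2 * α) * δ ≤ (1 - α₁) * δ₁ := by nlinarith [hα, hδ5, hαδ₁]
  have hδδ₁ : δ ≤ (1 - α₁) * δ₁ := hδ5.trans (by nlinarith [hαδ₁])
  have hα₁1 : α₁ ≤ 1 := by linarith
  have hαδ1 : α * δ ≤ δ := by linarith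
  have hc1 : 0 ≤ B6.c1 d₁ δ₁ α₁ := c1_nonneg d₁ δ₁ α₁
  set Mbig : ℝ := 2 * NF * θ₀ * B6.c1 d₁ δ₁ α₁ with hMbig
  refine thm310Printed_W310OfOps_strengthen h310 (max (max Mg 1) (max (max M₁ ML) (max MF Mbig))) (a₁ / c35)
    (div_pos ha₁ hc) fun i hM α₀ hα₀ hMa U hU hconv => ?_
  have hMg : Mg ≤ (geo i).M := le_trans (le_trans (le_max_left _ _) (le_max_left _ _)) hM
  have hM1 : 1 ≤ (geo i).M := le_trans (le_trans (le_max_right _ _) (le_max_left _ _)) hM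
  have hM₁i : M₁ ≤ (geo i).M := le_trans (le_trans (le_trans (le_max_left _ _) (le_max_left _ _)) (le_max_right _ _)) hM
  have hMLi : ML ≤ (geo i).M := le_trans (le_trans (le_trans (le_max_right _ _) (le_max_left _ _)) (le_max_right _ _)) hM
  have hMFi : MF ≤ (geo i).M := le_trans (le_trans (le_trans (le_max_left _ _) (le_max_right _ _)) (le_max_right _ _)) hM
  have hMb : Mbig ≤ (geo i).M := le_trans (le_trans (le_trans (le_max_right _ _) (le_max_right _ _)) (le_max_right _ _)) hM
  have hMpos : 0 < (geo i).M := lt_of_lt_of_le one_pos hM1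
  have ha : c35 * (geo i).M * α₀ ≤ a₁ := by
    have h1 : (geo i).M * α₀ * c35 ≤ a₁ := (le_div_iff₀ hc).mp hMa
    calc c35 * (geo i).M * α₀ = (geo i).M * α₀ * c35 := by ring
      _ ≤ a₁ := h1
  obtain ⟨h0, h1, h2, h3⟩ := hconv
  obtain ⟨hf, hi, hL, hFH⟩ := hop i hM₁i α₀ hα₀ ha U hU
  have hLap := hopL i hM₁i α₀ hα₀ ha U hU
  obtain ⟨hIL, hFI⟩ := hopI i hM₁i α₀ hα₀ ha U hU
  obtain ⟨hL2, hFL⟩ := hop2 i hM₁i α₀ hα₀ ha U hU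
  have hq : NF * (θ₀ * ((geo i).M)⁻¹) * B6.c1 d₁ δ₁ α₁ ≤ 1 / 2 :=
    small_of_threshold_nbr hMpos (by rw [hMbig] at hMb; exact hMb)
  have hF := hfacts i hMg
  have hF₁i := hF₁ i hMFi
  have hL₀ : 0 ≤ L₀ := le_trans (le_trans zero_le_one hF.one_le_L) hF.L_le
  have hlen : ∀ y : (geo i).Site, 0 < (geo i).len y := (hst i).lenpos
  -- the operator-level majorants of the members (3.43), (3.46)₅, (3.44)∕(3.45), (3.46)₄
  have hH := holder343_of_local310 (𝔬 i) (𝔭 i) (R i) (H i) d₁ δ₁ α₁ ρ N N' NF Cℓ θ₀ NH C δ (κ i) (SH i) Bl θH U hδ₁ hα₁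
    hα₁1 hNF hθ₀ hNH hM1 hC hδnn hδδ₁ (hst i) (hcntH i) hBl hθH (h261 i hMLi) hq hf hi hL hFH h2
  have hH' : ∀ β : ℝ, 0 ≤ β → β < 1 →
      HasMajorantHom (g := toB6 (geo i) (R i) (H i)) (𝔬 i).blk (𝔭 i).blkPY ((𝔭 i).ΦY U β ∘ₗ ((𝔬 i).D U ∘ₗ (𝔬 i).G U))
          (fun (a b : (geo i).Site) => holderConst d₁ δ₁ α₁ NH NF C (Bl β) (θH β) * (geo i).len a ^ (1 - β) *
            Real.exp (-(δ * (geo i).dist a b))) ∧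
        HasMajorantHom (g := toB6 (geo i) (R i) (H i)) (𝔬 i).blkY (𝔭 i).blkPX ((𝔭 i).ΦX U β ∘ₗ ((𝔬 i).G U ∘ₗ (𝔬 i).Dstar U))
          (fun (a b : (geo i).Site) => holderConst d₁ δ₁ α₁ NH NF C (Bl β) (θH β) * (geo i).len a ^ (1 - β) *
            Real.exp (-(δ * (geo i).dist a b))) := by
    intro β hβ0 hβ1
    have h := hH β hβ0 hβ1
    rw [LinearMap.comp_assoc] at h
    exact h
  have h5 := lap_of_local310 (𝔬 i) (R i) (H i) d₁ d₁' δ₁ α₁ ρ N N' NF Cℓ θ₀ NL BL L₀ (κ i) (SL i) U hδ₁ hα₁ hα₁2 hNF hθ₀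
    hNL hBL hMpos (hst i) (hcntL i) (h261 i hMLi) hF₁i hq hf hi hLap
  obtain ⟨h44, h45⟩ := input3445_of_local310 (𝔬 i) (𝔭 i) (R i) (H i) (bH i) d d₁ δ α L₀ δ₁ α₁ ρ N N' NF Cℓ θ₀ NH NI C
    (κ i) (SH i) (SI i) Bl θH BI θI BI2 U hδ₁ hα₁ hα₁1 hNF hθ₀ hNH hNI hM1 hC hδnn hδδ₁ hα hαδ1 (hst i) (hcntH i) (hcntI i)
    hBl hθH hBI hBI2 hθI (h261 i hMLi) hF hq hf hi hL hFH hIL hFI h1 h2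
  have hblk := l2line4_of_local310 (𝔬 i) (R i) (H i) d d₁ δ α L₀ δ₁ α₁ ρ N N' NF Cℓ N2 B2 θ2 C (κ i) (S2 i) U hNF hN2 hB2 hθ2
    hM1 hC hα2 hαδ₁ hrate (hst i) (hcnt2 i) (h261 i hMLi) hF hi hL2 hFL h1 h2 (htr i U)
  -- the nonnegativity of the operator-level constants
  have hK0 : ∀ β, 0 ≤ β → β < 1 → 0 ≤ holderConst d₁ δ₁ α₁ NH NF C (Bl β) (θH β) := by
    intro β hβ0 hβ1
    have hb := hBl β hβ0 hβ1
    have ht := hθH β hβ0 hβ1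
    unfold holderConst
    positivity
  have hK5 : 0 ≤ lapConst d₁ δ₁ α₁ NL BL L₀ := by unfold lapConst; positivity
  have hK4 : 0 ≤ twoConst d₁ δ₁ α₁ N2 B2 NF θ2 C L₀ := by unfold twoConst; positivity
  have hK44 : ∀ ε, 0 < ε → ε ≤ 1 → 0 ≤ inputConst44 d₁ δ₁ α₁ NI NF C L₀ (BI ε) (θI ε) := by
    intro ε hε0 hε1
    have hb := hBI ε hε0 hε1
    have ht := hθI ε hε0
    unfold inputConst44
    positivity
  have hK45 : ∀ ε β, 0 < ε → ε ≤ 1 → 0 ≤ β → β < 1 →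
      0 ≤ inputConst45 d₁ δ₁ α₁ NI NF L₀ (holderConst d₁ δ₁ α₁ NH NF C (Bl β) (θH β)) (BI2 ε β) (θI (β + ε)) := by
    intro ε β hε0 hε1 hβ0 hβ1
    have hb := hBI2 ε β hε0 hε1 hβ0 hβ1
    have ht := hθI (β + ε) (by linarith)
    have hh := hK0 β hβ0 hβ1
    unfold inputConst45
    positivity
  exact ⟨⟨h0, h1, h2, h3⟩, allIneqs_of_majorants_nbr (R := R i) (H := H i) (𝔭 i) (bH i) (𝔬 i).blk (𝔬 i).blkY (ev i) (evY i)
    (Rel i) m r Cev CL mN (hRlen i) (hRd₁ i) (hRd₂ i) (hmult i) (hnbr i) hCL1 (hCLcmp i) (htri i) hCev h0 h1 h2 h3 hH' h5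
    h44 h45 hblk (hsym i U) (htr i U) (hadjL i U)
    (hco0 i U) (hco1 i U) (hco2 i U) (hco3 i U) (hgl0 i U) (hgl1 i U) (hgl2 i U) (hgl3 i U) (hl0 i U) (hl1 i U) (hl2 i U)
    (hl3 i U) (hl4 i U) (hl5 i U) (hH1 i U) (hIR i U) hF (hdsymm i) (hst i).dnn hlen hC hK5 hK4 hK0 hK44 hK45 hα hδ₀nn hδ₀
    hδ₀2 hδ5 hCB hCg hCL hB5 hB4 hBβ hBε hBεβ⟩

end AllPinsG

/-! ## §3 ★★ Theorem 3.7 (the sum G′(U) of (3.90)) at the all-blocks pin with NO displayed residual, neighbourhood-sited readings -/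

section AllPinsGp

variable {I : Type} {c35 : ℝ} {geo : I → B9.Geometry} {bg : I → B9.Backgrounds}
variable [∀ i, Fintype (geo i).Site] [∀ i, DecidableEq (geo i).Site]

/-- Arithmetic of «for M sufficiently large»: a size s ≦ θ₀M⁻¹ and M ≧ 2N′B₁e^{δ₁ρ}θ₀c₁ give N′B₁e^{δ₁ρ}sc₁ ≦ ½ (twin of the siblings'
private lemma). [folklore] -/
private theorem small_of_size_nbr {N' B₀ ex s θ₀ c M : ℝ} (hN' : 0 ≤ N') (hB : 0 ≤ B₀ * ex) (hc : 0 ≤ c) (hM : 0 < M)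
    (hs : s ≤ θ₀ * M⁻¹) (hbig : 2 * N' * (B₀ * ex * θ₀) * c ≤ M) : N' * (B₀ * ex * s) * c ≤ 1 / 2 := by
  have h1 : N' * (B₀ * ex * s) * c ≤ N' * (B₀ * ex * (θ₀ * M⁻¹)) * c :=
    mul_le_mul_of_nonneg_right (mul_le_mul_of_nonneg_left (mul_le_mul_of_nonneg_left hs hB) hN') hc
  have h2 : N' * (B₀ * ex * (θ₀ * M⁻¹)) * c = (N' * (B₀ * ex * θ₀) * c) / M := by
    rw [div_eq_mul_inv]
    ring
  have h3 : (N' * (B₀ * ex * θ₀) * c) / M ≤ 1 / 2 := by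
    rw [div_le_iff₀ hM]
    linarith
  exact h1.trans (h2.le.trans h3)

/-- ★★ **THEOREM 3.7 AT THE ALL-BLOCKS PIN WITH NO DISPLAYED RESIDUAL, THE (3.43)–(3.46) CO-READINGS SITED ON THE NEIGHBOURHOOD** — p. 409:
*"The expansion is convergent in all norms appearing in the inequalities (3.42)–(3.47)"*; p. 410: *"Theorem 3.7 implies that all the
inequalities (3.42)–(3.47) hold for G′"*.  The `Nbr` form of `B9RWSumsAllBlocksRel.thm37Printed_allPin_completeRel`: the leaf `B9.Thm37Printed c35 geo bg
(fun i => E37AllOfOps (𝔴 i) (𝔬 i) (R i) (H i) C δ (K i) B₀ δ₀ Bβ Bε Bεβ)` from n06-c's leaf at the sup-block pin (`h37`) and, per member and per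
regular configuration, ONLY operator-level hypothesis schemas about the local operators G′_□(U) (`Local342`, `HolderLegs37`, `HolderV37`, `LapLegs37`,
`InputLegs37`, `L2TwoLegs37`), the elementary factors (`FactorsInput37`, `FactorsL2_37`), the structure (3.88) (`Identities`), the static data and
sizes, the letters, the member facts — and the co-readings of `K i` (`CoRealizesRel` relative to `Rel i`, `GlobReads`, and the neighbourhood-sited
`L2ReadsNbr`, `H1ReadsNbr`, `InputReadsNbr` of radius r) with class multiplicity ≦ m, neighbourhood count ≦ mN, level comparability CL and
evaluation constant Cev folded into the constants' relations.  Every member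
line PROVED inside through `holder343_of_local37`, `lap_of_local37`, `input3445_of_local37`, `l2line4_of_local37`, `blockBd_entry0∕1∕2`,
`blockBd_pair_of_transpose` and §1.  Nothing of print asserted; every input is a hypothesis; NOT a node discharge.
[cite: Balaban1985BackgroundPropagators, Thm 3.7 (3.88)–(3.90) p.409 + Thm 3.7 ⇒ Thm 3.1 p.410 + (3.42)–(3.47) pp.397–398 + Cor. 3.6 p.408; Balaban1984PropagatorsII, (2.51)–(2.52) p.232 + Lemma 2.1 (2.60)–(2.61) p.234] -/
theorem thm37Printed_allPin_completeNbr {X Y ι PX PY : I → Type} [∀ i, Fintype (X i)] [∀ i, DecidableEq (X i)]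
    [∀ i, Fintype (Y i)] [∀ i, DecidableEq (Y i)] [∀ i, Fintype (ι i)] [∀ i, Fintype (PX i)] [∀ i, DecidableEq (PX i)]
    [∀ i, Fintype (PY i)] [∀ i, DecidableEq (PY i)]
    {𝔴 : ∀ i, B9.RWExpansion (geo i) (bg i)} {𝔬 : ∀ i, Ops (geo i) (bg i) (X i) (Y i) (ι i)}
    {R : I → ℝ} {H : I → Prop} {C δ : ℝ}
    (𝔭 : ∀ i, HolderProbes (geo i) (bg i) (X i) (Y i) (PX i) (PY i))
    (bH : ∀ i, ℝ → BlockNorm (toB6 (geo i) (R i) (H i)) (Y i → ℝ))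
    (K : ∀ i, B9.KernelFamily (geo i) (bg i)) (ev : ∀ i, (geo i).Loc → X i → ℝ) (evY : ∀ i, (geo i).Loc → Y i → ℝ)
    (Rel : ∀ i, (geo i).Site → (geo i).Site → Prop) [∀ i, DecidableRel (Rel i)] (m : ℕ) (r Cev CL : ℝ) (mN : ℕ)
    {d : ℕ} {α L₀ B₀ δ₀ Mg : ℝ} {Bβ Bε : ℝ → ℝ} {Bεβ : ℝ → ℝ → ℝ}
    (κ : I → Sizes) (SH : ∀ i, ι i → Finset (geo i).Site) (Bl BV : ℝ → ℝ) (d₁ : ℕ)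
    (δ₁ α₁ ρ N N' Cℓ Kc θ₀ B₁ NH a₁ M₁ ML : ℝ)
    (SL : ∀ i, ι i → Finset (geo i).Site) (NL BL MF : ℝ) (d₁' : ℕ)
    (SI : ∀ i, ι i → Finset (geo i).Site) (NI : ℝ) (BI θI : ℝ → ℝ) (BI2 : ℝ → ℝ → ℝ)
    (S2 : ∀ i, ι i → Finset (geo i).Site) (N2 B2 θ2 : ℝ)
    (h37 : B9.Thm37Printed c35 geo bg (fun i => E37OfOps (𝔴 i) (𝔬 i) (R i) (H i) C δ))
    (hRlen : ∀ i (a a' : (geo i).Site), Rel i a a' → (geo i).len a = (geo i).len a')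
    (hRd₁ : ∀ i (a a' b : (geo i).Site), Rel i a a' → (geo i).dist a b = (geo i).dist a' b)
    (hRd₂ : ∀ i (a b b' : (geo i).Site), Rel i b b' → (geo i).dist a b = (geo i).dist a b')
    (hmult : ∀ i (y' : (geo i).Site), (Finset.univ.filter (fun y'' => Rel i y'' y')).card ≤ m)
    (hnbr : ∀ i (y : (geo i).Site), (nbr (geo i) r y).card ≤ mN) (hCL1 : 1 ≤ CL)
    (hCLcmp : ∀ i (a a' : (geo i).Site), (geo i).dist a a' ≤ r → (geo i).len a ≤ CL * (geo i).len a')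
    (htri : ∀ i (a b c : (geo i).Site), (geo i).dist a c ≤ (geo i).dist a b + (geo i).dist b c) (hCev : 0 ≤ Cev)
    (hco0 : ∀ i U, CoRealizesRel (K i) 0 U (Rel i) (𝔬 i).blk (𝔬 i).blk (ev i) ((𝔬 i).Gp U))
    (hco1 : ∀ i U, CoRealizesRel (K i) 1 U (Rel i) (𝔬 i).blkY (𝔬 i).blk (ev i) ((𝔬 i).D U ∘ₗ (𝔬 i).Gp U))
    (hco2 : ∀ i U, CoRealizesRel (K i) 2 U (Rel i) (𝔬 i).blk (𝔬 i).blkY (evY i) ((𝔬 i).Gp U ∘ₗ (𝔬 i).Dstar U))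
    (hco3 : ∀ i U, CoRealizesRel (K i) 3 U (Rel i) (𝔬 i).blk (𝔬 i).blk (ev i) ((𝔬 i).Lap U ∘ₗ (𝔬 i).Gp U))
    (hgl0 : ∀ i U, GlobReads (K i) 0 U (𝔬 i).blk (𝔬 i).blk (ev i) ((𝔬 i).Gp U))
    (hgl1 : ∀ i U, GlobReads (K i) 1 U (𝔬 i).blkY (𝔬 i).blk (ev i) ((𝔬 i).D U ∘ₗ (𝔬 i).Gp U))
    (hgl2 : ∀ i U, GlobReads (K i) 2 U (𝔬 i).blk (𝔬 i).blkY (evY i) ((𝔬 i).Gp U ∘ₗ (𝔬 i).Dstar U))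
    (hgl3 : ∀ i U, GlobReads (K i) 3 U (𝔬 i).blk (𝔬 i).blk (ev i) ((𝔬 i).Lap U ∘ₗ (𝔬 i).Gp U))
    (hl0 : ∀ i U, L2ReadsNbr (R := R i) (H := H i) (K i) 0 U (Rel i) r Cev (𝔬 i).blk (𝔬 i).blk (ev i) ((𝔬 i).Gp U))
    (hl1 : ∀ i U, L2ReadsNbr (R := R i) (H := H i) (K i) 1 U (Rel i) r Cev (𝔬 i).blkY (𝔬 i).blk (ev i) ((𝔬 i).D U ∘ₗ (𝔬 i).Gp U))
    (hl2 : ∀ i U, L2ReadsNbr (R := R i) (H := H i) (K i) 2 U (Rel i) r Cev (𝔬 i).blk (𝔬 i).blkY (evY i)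
      ((𝔬 i).Gp U ∘ₗ (𝔬 i).Dstar U))
    (hl3 : ∀ i U, L2ReadsNbr (R := R i) (H := H i) (K i) 3 U (Rel i) r Cev (𝔬 i).blk (𝔬 i).blk (ev i) ((𝔬 i).Lap U ∘ₗ (𝔬 i).Gp U))
    (hl4 : ∀ i U, L2ReadsNbr (R := R i) (H := H i) (K i) 4 U (Rel i) r Cev (𝔬 i).blkY (𝔬 i).blkY (evY i)
      ((𝔬 i).D U ∘ₗ ((𝔬 i).Gp U ∘ₗ (𝔬 i).Dstar U)))
    (hl5 : ∀ i U, L2ReadsNbr (R := R i) (H := H i) (K i) 5 U (Rel i) r Cev (𝔬 i).blk (𝔬 i).blk (ev i) ((𝔬 i).Gp U ∘ₗ (𝔬 i).Lap U))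
    (hH1 : ∀ i U, H1ReadsNbr (K i) U (𝔭 i) (Rel i) r (𝔬 i).blk (𝔬 i).blkY (ev i) (evY i) ((𝔬 i).D U ∘ₗ (𝔬 i).Gp U)
      ((𝔬 i).Gp U ∘ₗ (𝔬 i).Dstar U))
    (hIR : ∀ i U, InputReadsNbr (K i) U (𝔭 i) (bH i) r (𝔬 i).blkY (evY i)
      ((𝔬 i).D U ∘ₗ ((𝔬 i).Gp U ∘ₗ (𝔬 i).Dstar U)))
    (hsym : ∀ i U, IsTransposePair ((𝔬 i).Gp U) ((𝔬 i).Gp U))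
    (htr : ∀ i U, IsTransposePair ((𝔬 i).D U ∘ₗ (𝔬 i).Gp U) ((𝔬 i).Gp U ∘ₗ (𝔬 i).Dstar U))
    (hadjL : ∀ i U, IsTransposePair ((𝔬 i).Lap U ∘ₗ (𝔬 i).Gp U) ((𝔬 i).Gp U ∘ₗ (𝔬 i).Lap U))
    (hfacts : ∀ i, Mg ≤ (geo i).M → Facts347 (geo i) (R i) (H i) d δ α L₀)
    (hdsymm : ∀ i (a b : (geo i).Site), (geo i).dist a b = (geo i).dist b a)
    (hC : 0 ≤ C) (hCB : (m : ℝ) * C ≤ B₀) (hCL : (mN : ℝ) * m * Cev * CL ^ 2 * Real.exp (r * δ₀) * (C * L₀) ≤ B₀)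
    (hδ₀nn : 0 ≤ δ₀) (hδ₀ : δ₀ ≤ (1 - α) * δ)
    (hδ₀2 : δ₀ ≤ (1 - 2 * α) * δ) (hα : 0 ≤ α * δ) (hα2 : 2 * α * δ ≤ δ) (hCg : C * B6.c1 d δ (1 - α) * L₀ ^ (4 : ℝ) ≤ B₀)
    (hc : 0 < c35) (ha₁ : 0 < a₁) (hα₁ : 0 ≤ α₁) (hα₁2 : α₁ ≤ 1 / 2) (hN' : 0 ≤ N') (hCℓ : 0 ≤ Cℓ)
    (hB₁ : 0 ≤ B₁) (hNH : 0 ≤ NH) (hM₁ : 0 < M₁) (hδnn : 0 ≤ δ) (hδ5 : δ ≤ (1 - 2 * α₁) * δ₁) (hδ₁ : 0 ≤ δ₁) (hNL : 0 ≤ NL)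
    (hBL : 0 ≤ BL) (hNI : 0 ≤ NI) (hN2 : 0 ≤ N2) (hB2 : 0 ≤ B2) (hθ2 : 0 ≤ θ2)
    (hB5 : (mN : ℝ) * m * Cev * CL ^ 2 * Real.exp (r * δ₀) * (Real.sqrt (C * lapConst d₁ δ₁ α₁ NL BL L₀) * L₀) ≤ B₀)
    (hB4 : (mN : ℝ) * m * Cev * CL ^ 2 * Real.exp (r * δ₀) * twoConst d₁ δ₁ α₁ N2 B2 N' θ2 C L₀ ≤ B₀)
    (hst : ∀ i, StaticOK (𝔬 i) ρ N N' Cℓ (κ i)) (hκ : ∀ i, (κ i).Bounded Kc θ₀ Cℓ (geo i).M)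
    (hcntH : ∀ i (a : (geo i).Site), (∑ q, if a ∈ SH i q then (1 : ℝ) else 0) ≤ NH)
    (hcntL : ∀ i (a : (geo i).Site), (∑ q, if a ∈ SL i q then (1 : ℝ) else 0) ≤ NL)
    (hcntI : ∀ i (a : (geo i).Site), (∑ q, if a ∈ SI i q then (1 : ℝ) else 0) ≤ NI)
    (hcnt2 : ∀ i (a : (geo i).Site), (∑ q, if a ∈ S2 i q then (1 : ℝ) else 0) ≤ N2)
    (hBl : ∀ β, 0 ≤ β → β < 1 → 0 ≤ Bl β) (hBV : ∀ β, 0 ≤ β → β < 1 → 0 ≤ BV β)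
    (hBI : ∀ ε, 0 < ε → ε ≤ 1 → 0 ≤ BI ε) (hBI2 : ∀ ε β, 0 < ε → ε ≤ 1 → 0 ≤ β → β < 1 → 0 ≤ BI2 ε β)
    (hθI : ∀ ε, 0 < ε → 0 ≤ θI ε)
    (hBβ : ∀ β, 0 ≤ β → β < 1 → (m : ℝ) * CL * Real.exp (r * δ₀) * holderConst d₁ δ₁ α₁ NH N' C (Bl β) (BV β) ≤ Bβ β)
    (hBε : ∀ ε, 0 < ε → ε ≤ 1 → Real.exp (r * δ₀) * inputConst44 d₁ δ₁ α₁ NI N' C L₀ (BI ε) (θI ε) ≤ Bε ε)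
    (hBεβ : ∀ ε β, 0 < ε → ε ≤ 1 → 0 ≤ β → β < 1 →
      CL * Real.exp (r * δ₀) *
        inputConst45 d₁ δ₁ α₁ NI N' L₀ (holderConst d₁ δ₁ α₁ NH N' C (Bl β) (BV β)) (BI2 ε β) (θI (β + ε)) ≤ Bεβ ε β)
    (h261 : ∀ i, ML ≤ (geo i).M → Ineq261 d₁ (toB6 (geo i) (R i) (H i)) δ₁ α₁)
    (hF₁ : ∀ i, MF ≤ (geo i).M → Facts347 (geo i) (R i) (H i) d₁' δ₁ α₁ L₀)
    (hop : ∀ i, M₁ ≤ (geo i).M → ∀ α₀ : ℝ, 0 < α₀ → c35 * (geo i).M * α₀ ≤ a₁ →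
      ∀ U : (bg i).Cfg, (bg i).Reg335 c35 α₀ U →
        Local342 (𝔬 i) (R i) (H i) B₁ δ₁ U ∧ Identities (𝔬 i) (R i) (H i) U ∧
          HolderLegs37 (𝔬 i) (𝔭 i) (R i) (H i) (SH i) Bl δ₁ U ∧ HolderV37 (𝔬 i) (𝔭 i) (R i) (H i) BV δ₁ U)
    (hopL : ∀ i, M₁ ≤ (geo i).M → ∀ α₀ : ℝ, 0 < α₀ → c35 * (geo i).M * α₀ ≤ a₁ →
      ∀ U : (bg i).Cfg, (bg i).Reg335 c35 α₀ U → LapLegs37 (𝔬 i) (R i) (H i) (SL i) BL δ₁ U)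
    (hopI : ∀ i, M₁ ≤ (geo i).M → ∀ α₀ : ℝ, 0 < α₀ → c35 * (geo i).M * α₀ ≤ a₁ →
      ∀ U : (bg i).Cfg, (bg i).Reg335 c35 α₀ U →
        InputLegs37 (𝔬 i) (𝔭 i) (R i) (H i) (bH i) (SI i) BI BI2 δ₁ U ∧ FactorsInput37 (𝔬 i) (R i) (H i) (bH i) θI δ₁ U)
    (hop2 : ∀ i, M₁ ≤ (geo i).M → ∀ α₀ : ℝ, 0 < α₀ → c35 * (geo i).M * α₀ ≤ a₁ →
      ∀ U : (bg i).Cfg, (bg i).Reg335 c35 α₀ U →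
        L2TwoLegs37 (𝔬 i) (R i) (H i) (S2 i) B2 δ₁ U ∧ FactorsL2_37 (𝔬 i) (R i) (H i) θ2 δ₁ U) :
    B9.Thm37Printed c35 geo bg (fun i => E37AllOfOps (𝔴 i) (𝔬 i) (R i) (H i) C δ (K i) B₀ δ₀ Bβ Bε Bεβ) := by
  have hαδ₁ : 0 ≤ α₁ * δ₁ := mul_nonneg hα₁ hδ₁
  have hrate : (1 - 2 * α) * δ ≤ (1 - α₁) * δ₁ := by nlinarith [hα, hδ5, hαδ₁]
  have hδδ₁ : δ ≤ (1 - α₁) * δ₁ := hδ5.trans (by nlinarith [hαδ₁])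
  have hα₁1 : α₁ ≤ 1 := by linarith
  have hαδ1 : α * δ ≤ δ := by linarith
  have hc1 : 0 ≤ B6.c1 d₁ δ₁ α₁ := c1_nonneg d₁ δ₁ α₁
  have hBe : 0 ≤ B₁ * Real.exp (δ₁ * ρ) := mul_nonneg hB₁ (Real.exp_nonneg _)
  set Mbig : ℝ := 2 * N' * (B₁ * Real.exp (δ₁ * ρ) * θ₀) * B6.c1 d₁ δ₁ α₁ with hMbig
  refine thm37Printed_strengthen h37 (max (max Mg M₁) (max (max ML MF) Mbig)) (a₁ / c35) (div_pos ha₁ hc)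
    fun i hM α₀ hα₀ hMa U hU hconv => ?_
  have hMg : Mg ≤ (geo i).M := le_trans (le_trans (le_max_left _ _) (le_max_left _ _)) hM
  have hM₁i : M₁ ≤ (geo i).M := le_trans (le_trans (le_max_right _ _) (le_max_left _ _)) hM
  have hMLi : ML ≤ (geo i).M := le_trans (le_trans (le_trans (le_max_left _ _) (le_max_left _ _)) (le_max_right _ _)) hM
  have hMFi : MF ≤ (geo i).M := le_trans (le_trans (le_trans (le_max_right _ _) (le_max_left _ _)) (le_max_right _ _)) hM
  have hMb : Mbig ≤ (geo i).M := le_trans (le_trans (le_max_right _ _) (le_max_right _ _)) hM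
  have hMpos : 0 < (geo i).M := lt_of_lt_of_le hM₁ hM₁i
  have ha : c35 * (geo i).M * α₀ ≤ a₁ := by
    have h1 : (geo i).M * α₀ * c35 ≤ a₁ := (le_div_iff₀ hc).mp hMa
    calc c35 * (geo i).M * α₀ = (geo i).M * α₀ * c35 := by ring
      _ ≤ a₁ := h1
  have hconv' : Conv342 (𝔬 i) (R i) (H i) C δ U := hconv
  obtain ⟨h0, h1, h2, h3⟩ := hconv'
  obtain ⟨hl, hi, hL, hV⟩ := hop i hM₁i α₀ hα₀ ha U hU
  have hLap := hopL i hM₁i α₀ hα₀ ha U hU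
  obtain ⟨hIL, hFI⟩ := hopI i hM₁i α₀ hα₀ ha U hU
  obtain ⟨hL2, hFL⟩ := hop2 i hM₁i α₀ hα₀ ha U hU
  have hq : N' * (B₁ * Real.exp (δ₁ * ρ) * ((κ i).kP + (κ i).kC)) * B6.c1 d₁ δ₁ α₁ ≤ 1 / 2 :=
    small_of_size_nbr hN' hBe hc1 hMpos (hκ i).row (by rw [hMbig] at hMb; exact hMb)
  have hq' : N' * (B₁ * Real.exp (δ₁ * ρ) * ((κ i).kPt + Cℓ * (κ i).kCt)) * B6.c1 d₁ δ₁ α₁ ≤ 1 / 2 :=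
    small_of_size_nbr hN' hBe hc1 hMpos (hκ i).col (by rw [hMbig] at hMb; exact hMb)
  have hF := hfacts i hMg
  have hF₁i := hF₁ i hMFi
  have hL₀ : 0 ≤ L₀ := le_trans (le_trans zero_le_one hF.one_le_L) hF.L_le
  have hlen : ∀ y : (geo i).Site, 0 < (geo i).len y := (hst i).lenpos
  -- the operator-level majorants of the members (3.43), (3.46)₅, (3.44)∕(3.45), (3.46)₄
  have hH := holder343_of_local37 (𝔬 i) (𝔭 i) (R i) (H i) d₁ δ₁ α₁ ρ B₁ N N' Cℓ NH C δ (κ i) (SH i) Bl BV U hB₁ hδ₁ hα₁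
    hα₁1 hN' hNH hC hδnn hδδ₁ (hst i) (hκ i).nonneg (hcntH i) hBl hBV (h261 i hMLi) hq hl hi hL hV h2
  have hH' : ∀ β : ℝ, 0 ≤ β → β < 1 →
      HasMajorantHom (g := toB6 (geo i) (R i) (H i)) (𝔬 i).blk (𝔭 i).blkPY ((𝔭 i).ΦY U β ∘ₗ ((𝔬 i).D U ∘ₗ (𝔬 i).Gp U))
          (fun (a b : (geo i).Site) => holderConst d₁ δ₁ α₁ NH N' C (Bl β) (BV β) * (geo i).len a ^ (1 - β) *
            Real.exp (-(δ * (geo i).dist a b))) ∧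
        HasMajorantHom (g := toB6 (geo i) (R i) (H i)) (𝔬 i).blkY (𝔭 i).blkPX ((𝔭 i).ΦX U β ∘ₗ ((𝔬 i).Gp U ∘ₗ (𝔬 i).Dstar U))
          (fun (a b : (geo i).Site) => holderConst d₁ δ₁ α₁ NH N' C (Bl β) (BV β) * (geo i).len a ^ (1 - β) *
            Real.exp (-(δ * (geo i).dist a b))) := by
    intro β hβ0 hβ1
    have h := hH β hβ0 hβ1
    rw [LinearMap.comp_assoc] at h
    exact h
  have h5 := lap_of_local37 (𝔬 i) (R i) (H i) d₁ d₁' δ₁ α₁ ρ B₁ N N' Cℓ NL BL L₀ (κ i) (SL i) U hB₁ hδ₁ hα₁ hα₁2 hN' hCℓ hNL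
    hBL (hst i) (hκ i).nonneg (hcntL i) (h261 i hMLi) hF₁i hq' hl hi hLap
  obtain ⟨h44, h45⟩ := input3445_of_local37 (𝔬 i) (𝔭 i) (R i) (H i) (bH i) d d₁ δ α L₀ δ₁ α₁ ρ B₁ N N' Cℓ NH NI C (κ i)
    (SH i) (SI i) Bl BV BI θI BI2 U hB₁ hδ₁ hα₁ hα₁1 hN' hNH hNI hC hδnn hδδ₁ hα hαδ1 (hst i) (hκ i).nonneg (hcntH i) (hcntI i)
    hBl hBV hBI hBI2 hθI (h261 i hMLi) hF hq hl hi hL hV hIL hFI h1 h2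
  have hblk := l2line4_of_local37 (𝔬 i) (R i) (H i) d d₁ δ α L₀ δ₁ α₁ ρ N N' Cℓ N2 B2 θ2 C (κ i) (S2 i) U hN' hN2 hB2 hθ2 hC
    hα2 hαδ₁ hrate (hst i) (hcnt2 i) (h261 i hMLi) hF hi hL2 hFL h1 h2 (htr i U)
  -- the nonnegativity of the operator-level constants
  have hK0 : ∀ β, 0 ≤ β → β < 1 → 0 ≤ holderConst d₁ δ₁ α₁ NH N' C (Bl β) (BV β) := by
    intro β hβ0 hβ1
    have hb := hBl β hβ0 hβ1
    have hv := hBV β hβ0 hβ1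
    unfold holderConst
    positivity
  have hK5 : 0 ≤ lapConst d₁ δ₁ α₁ NL BL L₀ := by unfold lapConst; positivity
  have hK4 : 0 ≤ twoConst d₁ δ₁ α₁ N2 B2 N' θ2 C L₀ := by unfold twoConst; positivity
  have hK44 : ∀ ε, 0 < ε → ε ≤ 1 → 0 ≤ inputConst44 d₁ δ₁ α₁ NI N' C L₀ (BI ε) (θI ε) := by
    intro ε hε0 hε1
    have hb := hBI ε hε0 hε1
    have ht := hθI ε hε0
    unfold inputConst44
    positivity
  have hK45 : ∀ ε β, 0 < ε → ε ≤ 1 → 0 ≤ β → β < 1 →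
      0 ≤ inputConst45 d₁ δ₁ α₁ NI N' L₀ (holderConst d₁ δ₁ α₁ NH N' C (Bl β) (BV β)) (BI2 ε β) (θI (β + ε)) := by
    intro ε β hε0 hε1 hβ0 hβ1
    have hb := hBI2 ε β hε0 hε1 hβ0 hβ1
    have ht := hθI (β + ε) (by linarith)
    have hh := hK0 β hβ0 hβ1
    unfold inputConst45
    positivity
  exact ⟨⟨h0, h1, h2, h3⟩, allIneqs_of_majorants_nbr (R := R i) (H := H i) (𝔭 i) (bH i) (𝔬 i).blk (𝔬 i).blkY (ev i)
    (evY i) (Rel i) m r Cev CL mN (hRlen i) (hRd₁ i) (hRd₂ i) (hmult i) (hnbr i) hCL1 (hCLcmp i) (htri i) hCev h0 h1 h2 h3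
    hH' h5 h44 h45 hblk (hsym i U) (htr i U) (hadjL i U)
    (hco0 i U) (hco1 i U) (hco2 i U) (hco3 i U) (hgl0 i U) (hgl1 i U) (hgl2 i U) (hgl3 i U) (hl0 i U) (hl1 i U) (hl2 i U)
    (hl3 i U) (hl4 i U) (hl5 i U) (hH1 i U) (hIR i U) hF (hdsymm i) (hst i).dnn hlen hC hK5 hK4 hK0 hK44 hK45 hα hδ₀nn hδ₀
    hδ₀2 hδ5 hCB hCg hCL hB5 hB4 hBβ hBε hBεβ⟩

end AllPinsGp

end

end Literature.MathematicalPhysics.QuantumFieldTheory.Balaban1983to89.B9RWSumsAllBlocksNbr
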